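import Literature.Analysis.FluidPDE.PlanarVorticityLpDecay
import Literature.Analysis.FluidPDE.BiotSavart2DSupInterpolation
import Literature.Analysis.FluidPDE.BiotSavart2DSharpSupBound
import Literature.Analysis.FluidPDE.LundgrenCrossSectionMoments
import HarnessLib

/-!
# Uniform decay of the velocity of a planar viscous flow, `‖u(t)‖_∞ ≤ K ‖ω‖₁ (ν t)^{-1/2}`,
# and the Burgers-scale ceiling for the swirl of Lundgren's stretched tube

Literature file (topic `Analysis/FluidPDE`), all results proved, no definitions, no named facts.
Two printed ingredients are combined:

* Gallay–Wayne 2002, Lemma 2.1 (b) (`|u|_∞ ≤ C |ω|_p^α |ω|_q^{1−α}`, here `p = 1`, `q = 4`,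
  `α = 1/3`), in the tree's cut-off form `norm_biotSavart2D_le_of_radius_L4`
  (`BiotSavart2DSupInterpolation`);
* Gallay–Wayne 2005, Thm. 1.1 eq. (1.2) for `p = 4` (`|ω(t)|_4 ≤ C_4 |ω₀|_1 t^{-3/4}`), in the
  tree's form `IsClassicalNSSolutionOn.integral_pow_four_planarVorticity_le_of_integral_abs_le`
  (`PlanarVorticityLpDecay`),

with the radius `R = (ν (t − t₀))^{1/2}`, into

* §1 **`IsClassicalNSSolutionOn.norm_le_of_integral_abs_le`**: for a classical planar
  Navier–Stokes solution on a convex time set (`ν > 0`, curl-free force, uniformly rapidly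
  decaying vorticity, `u = K₂ ∗ ω`) with `‖ω(s)‖₁ ≤ m` on `[t₀, t]`,
  `‖u(t, x)‖ ≤ K m / (ν (t − t₀))^{1/2}` for every `x`, with the explicit constant
  `K = (2π)⁻¹ ((3π)^{3/4} ((128/3) C_GNS³)^{1/4} + 1)`, `C_GNS = lintegralPowLePowLIntegralFDerivConst volume 2`;
  and `norm_le_of_planarVorticity_nonneg_of_lt`: for `ω(t₀) ≥ 0`, `m = Γ = ∫ ω(t₀)` (Kelvin) —
  a velocity bound by the CIRCULATION alone, decaying like `(ν t)^{-1/2}` (the tree's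
  `norm_le_two_mul_sqrt_of_planarVorticity_nonneg` needs the initial peak and does not decay);
* §2 (namespace `Lundgren`) the reading through Lundgren's transformation (Saffman §13.3 (28)–(29),
  `LundgrenStrainedPlanarFlows`, `LundgrenCrossSectionMoments`): the swirl part
  `a(t) ṽ(τ(t), a(t) x̃)` of the stretched flow carrying ANY non-negative cross-section satisfies
  `‖a(t) ṽ(τ(t), a(t)y)‖ ≤ |a(t)| K Γ/(ν (τ(t) − τ(t₀)))^{1/2}`
  (`norm_swirl_lundgren_le_of_circulation`), and at CONSTANT strain rate `c > 0`
  (`a = e^{ct/2}`, `τ = (e^{ct} − 1)/c`)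
  **`‖swirl(t, ·)‖_∞ ≤ K Γ (c/(ν (1 − e^{−c(t−t₀)})))^{1/2}`**
  (`norm_swirl_lundgren_const_le_of_circulation`): UNIFORM in time, saturating at the Burgers
  scale `Γ (c/ν)^{1/2}` — the ceiling companion of the tree's floor after the compaction budget,
  `integral_curl_lundgren_const_swirl_floor_of_budget` (`U ≥ (Γ/8π)(c/ρν)^{1/2}`), whereas the
  earlier ceiling `norm_swirl_lundgren_le_sqrt` grows like the stretch `e^{c(t−t₀)/2}`.

* §2 (v2) the same for the AXIAL VORTICITY itself, from the `L^∞` endpoint of (1.2)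
  (`PlanarVorticityLpDecay` §6, the full Nash–Moser iteration):
  `0 ≤ ω_z(t, x) ≤ a(t)² · 8 C_GNS Γ/(ν (τ(t) − τ(t₀)))` (`curl_lundgren_le_of_circulation`) and at
  constant strain **`ω_z(t, x) ≤ 8 C_GNS Γ c/(ν (1 − e^{−c(t−t₀)}))`**
  (`curl_lundgren_const_le_of_circulation`) — UNIFORM, the Burgers scale `Γc/ν` (Burgers' peak is
  `Γc/(4πν)`); the earlier ceiling `abs_curl_lundgren_const_le_exp_mul` grows like `e^{c(t−t₀)}`.

* (v3) SIGNED data / cross-sections, by the `L¹` contraction (`PlanarVorticityLpDecay` §7) in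
  place of Kelvin: `IsClassicalNSSolutionOn.norm_le_of_lt` (`‖u(t)‖_∞ ≤ K‖ω(t₀)‖₁(ν(t−t₀))^{-1/2}`),
  `Lundgren.norm_swirl_abs_curl_lundgren_le_of_crossSection` and
  `Lundgren.norm_swirl_abs_curl_lundgren_const_le_of_crossSection` (the same ceilings with the
  cross-section `L¹` norm `N = ∫|ω_z(t₀)|` in place of `Γ`, no co-sign).

* (v4) **THE SHARP-KERNEL ROUTE WITH EXPLICIT CONSTANTS** (§3): the v5 explicit `L^∞` bound of
  `PlanarVorticityLpDecay` (`‖ω(t)‖_∞ ≤ m/(ν(t−t₀))`, Nash constant `1/8`) composed with the SHARP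
  kinematic bound `‖K₂ ∗ ω‖_∞ ≤ (‖ω‖_∞‖ω‖₁/4π)^{1/2}` (co-signed) / `(‖ω‖_∞‖ω‖₁/2π)^{1/2}` (signed)
  of `BiotSavart2DSharpSupBound` gives NUMBERS, with no `L⁴` step:
  `‖u(t, x)‖ ≤ m (2πν(t−t₀))^{-1/2}` (signed, `norm_le_div_sqrt_of_integral_abs_le`, `…_of_lt`),
  **`‖u(t, x)‖ ≤ Γ (4πν(t−t₀))^{-1/2}`** for `ω(t₀) ≥ 0`
  (`norm_le_div_sqrt_of_planarVorticity_nonneg_of_lt`; the Lamb–Oseen maximum is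
  `0.0451·Γ(ν t)^{-1/2}`, this is `0.2821·`); through Lundgren (namespace `Lundgren`, §3):
  `‖a(t)ṽ(τ(t),a(t)y)‖ ≤ |a(t)| Γ (4πν(τ(t)−τ(t₀)))^{-1/2}`, at constant strain
  **`‖swirl(t)‖_∞ ≤ Γ (c/(4πν(1 − e^{−c(t−t₀)})))^{1/2}`** and
  **`0 ≤ ω_z(t, x) ≤ Γc/(ν(1 − e^{−c(t−t₀)}))`** (`…_sharp` / `…_explicit`; Burgers' own peak and
  maximal swirl are `Γc/(4πν)` and `0.0508·Γ(c/ν)^{1/2}·…`), and the signed twins with `N`, `2π`.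

* (v5) `Lundgren.norm_swirl_lundgren_le_sqrt_sharp`: the EARLY-window companion — the stretch bound
  `‖a(t)ṽ(τ(t),a(t)y)‖ ≤ |a(t)|(B a(t₀)⁻²Γ/4π)^{1/2}` of `LundgrenCrossSectionMoments.norm_swirl_lundgren_le_sqrt`
  with the sharp kinematic constant (÷ 2√2).

## What is NOT here

* (superseded by v3) Signed cross-sections: §2 takes `ω_z(t₀) ≥ 0` so that `‖ω̃‖₁ = Γ` is conserved; for signed data
  the running `L¹` bound of §1 would have to be supplied (`L¹`-contraction, Ben-Artzi 1994).

HONEST FRAMING (cell `ns-blowup`, bears_on LADDER-NS N1 crux `HeredityFromTwo`, UPPER half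
`WindowCeilingAt`; MODEL identification «child core = Lundgren cross-section»): exact a-priori
bounds for infinite-energy 2½-D flows; nothing asserts `AprioriCeiling`, `WindowCeilingAt`,
`HeredityFromTwo` or anything about finite-energy / Clay-class Navier–Stokes flows.

## References

* [GallayWayne2002] Th. Gallay, C. E. Wayne, Arch. Ration. Mech. Anal. 163 (2002) 209–258 =
  arXiv:math/0102197 — Lemma 2.1 (b) (materialised text p. 6).
* [GallayWayne2005] Th. Gallay, C. E. Wayne, Comm. Math. Phys. 255 (2005) 97–129 =
  arXiv:math/0402449 — Thm. 1.1 eq. (1.2) (materialised text p. 3).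
* [Saffman1992] P. G. Saffman, *Vortex Dynamics*, CUP 1992, §13.3 eqs. (26)–(31) (Lundgren's
  transformation and the Burgers vortex).
* [MajdaBertozziCUP2002] A. J. Majda, A. L. Bertozzi, CUP 2002 — §8.2.3 (8.27), §1.7 Prop. 1.14.
* [IftimieSiderisGamblin1999] D. Iftimie, T. C. Sideris, P. Gamblin, Comm. PDE 24 (1999) — Lemma 2.1
  (the `L¹–L^∞` interpolation bound for `K₂ ∗ ω`; sharpened in `BiotSavart2DSharpSupBound`).
-/


noncomputable section

open MeasureTheory Set Function Filter Metric InnerProductSpace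
open _root_.Topology
open scoped ENNReal Topology RealInnerProductSpace ContDiff

namespace Literature.Analysis.FluidPDE

/-! ### §0 The constant and its `rpow` algebra -/

section Algebra

/-- The algebra of the radius choice `R = s = (ν t)^{1/2}` in the `L⁴ × L¹` velocity bound:
`(3π s^{2/3})^{3/4} · ((K₂ m s^{-3/2})⁴)^{1/4} = (3π)^{3/4} K₂ m / s` for `s > 0`, `K₂, m ≥ 0`.
[folklore] -/
private theorem radius_algebra {s K₂ m : ℝ} (hs : 0 < s) (hK : 0 ≤ K₂) (hm : 0 ≤ m) :
    (3 * Real.pi * s ^ (2 / 3 : ℝ)) ^ (3 / 4 : ℝ) * ((K₂ * m * s ^ (-(3 / 2) : ℝ)) ^ 4) ^ (1 / 4 : ℝ) =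
      (3 * Real.pi) ^ (3 / 4 : ℝ) * K₂ * m / s := by
  have hs0 : 0 ≤ s := hs.le
  have hπ : 0 ≤ 3 * Real.pi := by positivity
  have h1 : (3 * Real.pi * s ^ (2 / 3 : ℝ)) ^ (3 / 4 : ℝ) = (3 * Real.pi) ^ (3 / 4 : ℝ) * s ^ (1 / 2 : ℝ) := by
    rw [Real.mul_rpow hπ (Real.rpow_nonneg hs0 _), ← Real.rpow_mul hs0]
    norm_num
  have hX : 0 ≤ K₂ * m * s ^ (-(3 / 2) : ℝ) := by positivity
  have h2 : ((K₂ * m * s ^ (-(3 / 2) : ℝ)) ^ 4) ^ (1 / 4 : ℝ) = K₂ * m * s ^ (-(3 / 2) : ℝ) := by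
    rw [show (1 / 4 : ℝ) = ((4 : ℕ) : ℝ)⁻¹ by norm_num]
    exact Real.pow_rpow_inv_natCast hX (by norm_num)
  have h3 : s ^ (1 / 2 : ℝ) * s ^ (-(3 / 2) : ℝ) = s⁻¹ := by
    rw [← Real.rpow_add hs, show (1 / 2 : ℝ) + -(3 / 2) = -1 by norm_num, Real.rpow_neg_one]
  rw [h1, h2, eq_div_iff hs.ne']
  calc (3 * Real.pi) ^ (3 / 4 : ℝ) * s ^ (1 / 2 : ℝ) * (K₂ * m * s ^ (-(3 / 2) : ℝ)) * s
      = (3 * Real.pi) ^ (3 / 4 : ℝ) * K₂ * m * ((s ^ (1 / 2 : ℝ) * s ^ (-(3 / 2) : ℝ)) * s) := by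
        ring
    _ = (3 * Real.pi) ^ (3 / 4 : ℝ) * K₂ * m := by rw [h3, inv_mul_cancel₀ hs.ne', mul_one]

/-- `(128/3) C³ m⁴ / (s²)³ = (((128/3) C³)^{1/4} m s^{-3/2})⁴` for `s > 0`, `C ≥ 0`. [folklore] -/
private theorem bound_eq_pow_four {s C m : ℝ} (hs : 0 < s) (hC : 0 ≤ C) :
    128 / 3 * C ^ 3 * m ^ 4 / (s ^ 2) ^ 3 =
      ((128 / 3 * C ^ 3) ^ (1 / 4 : ℝ) * m * s ^ (-(3 / 2) : ℝ)) ^ 4 := by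
  have hs0 : 0 ≤ s := hs.le
  have hK : 0 ≤ 128 / 3 * C ^ 3 := by positivity
  have h1 : ((128 / 3 * C ^ 3) ^ (1 / 4 : ℝ)) ^ 4 = 128 / 3 * C ^ 3 := by
    rw [show (1 / 4 : ℝ) = ((4 : ℕ) : ℝ)⁻¹ by norm_num]
    exact Real.rpow_inv_natCast_pow hK (by norm_num)
  have h2 : (s ^ (-(3 / 2) : ℝ)) ^ 4 = (s ^ 6)⁻¹ := by
    rw [← Real.rpow_natCast (s ^ (-(3 / 2) : ℝ)) 4, ← Real.rpow_mul hs0,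
      show (-(3 / 2) : ℝ) * ((4 : ℕ) : ℝ) = -((6 : ℕ) : ℝ) by norm_num, Real.rpow_neg hs0,
      Real.rpow_natCast]
  rw [mul_pow, mul_pow, h1, h2, ← pow_mul]
  norm_num
  ring

end Algebra

/-! ### §1 The velocity of a planar viscous flow decays like `(ν t)^{-1/2}` -/

section Planar

variable {S : Set ℝ} {ν : ℝ} {f u : ℝ → EuclideanSpace ℝ (Fin 2) → EuclideanSpace ℝ (Fin 2)}
  {p : ℝ → EuclideanSpace ℝ (Fin 2) → ℝ}

/-- The scalar vorticity of a `C¹` planar field is continuous. [folklore] -/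
private theorem continuous_planarVorticity {v : EuclideanSpace ℝ (Fin 2) → EuclideanSpace ℝ (Fin 2)}
    (hv : ContDiff ℝ 1 v) : Continuous (PlanarEigenmode.vorticity v) := by
  have hc : ∀ e : EuclideanSpace ℝ (Fin 2), Continuous fun x => fderiv ℝ v x e := fun e =>
    (hv.continuous_fderiv one_ne_zero).clm_apply continuous_const
  have hcomp : ∀ (e : EuclideanSpace ℝ (Fin 2)) (i : Fin 2), Continuous fun x => fderiv ℝ v x e i :=
    fun e i => (PiLp.continuous_apply 2 (fun _ : Fin 2 => ℝ) i).comp (hc e)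
  unfold PlanarEigenmode.vorticity
  exact (hcomp _ 1).sub (hcomp _ 0)

/-- The velocity of a `K₂ ∗ ω` planar flow with uniformly rapidly decaying vorticity is bounded
at each time (MB (8.27)). [cite: MajdaBertozziCUP2002, §8.2.3 Prop. 8.2 (i) (8.27) (held text p. 275)] -/
theorem exists_norm_le_of_hasUniformRapidDecayOn_of_eq_biotSavart2D
    (hu : IsSmoothSpaceTimeOn S u)
    (hω : HasUniformRapidDecayOn S (fun t x => PlanarEigenmode.vorticity (u t) x))
    (hBS : ∀ t ∈ S, ∀ x, u t x = biotSavart2D (PlanarEigenmode.vorticity (u t)) x) {t : ℝ}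
    (ht : t ∈ S) : ∃ M : ℝ, ∀ x, ‖u t x‖ ≤ M := by
  obtain ⟨C, hC0, hC⟩ := hω.norm_le_rpow 3
  have hωc : Continuous (PlanarEigenmode.vorticity (u t)) :=
    continuous_planarVorticity (contDiff_infty.1 (hu.contDiff_slice ht) 1)
  have hwi : Integrable (PlanarEigenmode.vorticity (u t)) := by
    refine integrable_of_norm_le_rpow_neg hωc (C := C) (r := ((3 : ℕ) : ℝ)) ?_ fun x => hC t ht x
    rw [finrank_euclideanSpace_fin]; norm_num
  have hA : ∀ y, |PlanarEigenmode.vorticity (u t) y| ≤ C := fun y => by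
    have h := hC t ht y
    rw [Real.norm_eq_abs] at h
    exact h.trans (mul_le_of_le_one_right hC0 (rpow_neg_le_one y (by norm_num)))
  exact exists_norm_le_of_eq_biotSavart2D hwi hA (hBS t ht)

/-- **The velocity of a planar viscous flow decays like `‖ω‖₁ (ν t)^{-1/2}`, uniformly in space.**
Let `(u, p)` be a classical planar Navier–Stokes solution on a convex time set `S` with `ν > 0` and
curl-free force, whose vorticity has uniform rapid decay on `S` and whose velocity is the
Biot–Savart velocity of its vorticity. If `‖ω(s)‖_{L¹} ≤ m` for all `s ∈ [t₀, t] ⊆ S` (`t₀ < t`),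
then for every `x`:
`‖u(t, x)‖ ≤ (2π)⁻¹ ((3π)^{3/4} ((128/3) C_GNS³)^{1/4} + 1) · m / (ν (t − t₀))^{1/2}`
— Gallay–Wayne 2002 Lemma 2.1 (b) `|u|_∞ ≤ C|ω|₁^{1/3}|ω|₄^{2/3}` (cut-off form, radius
`R = (ν (t − t₀))^{1/2}`) combined with the `L⁴` smoothing estimate
`‖ω(t)‖₄⁴ ≤ (128/3) C_GNS³ m⁴/(ν (t − t₀))³` (Gallay–Wayne 2005 (1.2)).
[cite: GallayWayne2002, Lemma 2.1 (b) (p = 1, q = 4); GallayWayne2005, Thm. 1.1 eq. (1.2) (p = 4)] -/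
theorem IsClassicalNSSolutionOn.norm_le_of_integral_abs_le
    (h : IsClassicalNSSolutionOn S ν f u p) (hS : Convex ℝ S) (hν : 0 < ν)
    (hcurl : ∀ t ∈ S, ∀ x, PlanarEigenmode.vorticity (f t) x = 0)
    (hω : HasUniformRapidDecayOn S (fun t x => PlanarEigenmode.vorticity (u t) x))
    (hBS : ∀ t ∈ S, ∀ x, u t x = biotSavart2D (PlanarEigenmode.vorticity (u t)) x) {t₀ t : ℝ}
    (ht₀ : t₀ ∈ S) (ht : t ∈ S) (htt : t₀ < t) {m : ℝ}
    (hm : ∀ s ∈ Icc t₀ t, ∫ x, |PlanarEigenmode.vorticity (u s) x| ≤ m)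
    (x : EuclideanSpace ℝ (Fin 2)) :
    ‖u t x‖ ≤ (2 * Real.pi)⁻¹ * ((3 * Real.pi) ^ (3 / 4 : ℝ) *
        (128 / 3 * (lintegralPowLePowLIntegralFDerivConst
          (volume : Measure (EuclideanSpace ℝ (Fin 2))) 2 : ℝ) ^ 3) ^ (1 / 4 : ℝ) + 1) *
      m / Real.sqrt (ν * (t - t₀)) := by
  set Cg : ℝ := (lintegralPowLePowLIntegralFDerivConst
    (volume : Measure (EuclideanSpace ℝ (Fin 2))) 2 : ℝ) with hCg
  have hCg0 : 0 ≤ Cg := NNReal.coe_nonneg _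
  set K₂ : ℝ := (128 / 3 * Cg ^ 3) ^ (1 / 4 : ℝ) with hK₂
  have hK₂0 : 0 ≤ K₂ := Real.rpow_nonneg (by positivity) _
  have hτ : 0 < ν * (t - t₀) := mul_pos hν (sub_pos.2 htt)
  set s : ℝ := Real.sqrt (ν * (t - t₀)) with hs_def
  have hs : 0 < s := Real.sqrt_pos.2 hτ
  have hs2 : s ^ 2 = ν * (t - t₀) := Real.sq_sqrt hτ.le
  have hm0 : 0 ≤ m := (integral_nonneg fun y => abs_nonneg _).trans (hm t (right_mem_Icc.2 htt.le))
  have hbdd : ∀ s ∈ S, ∃ M : ℝ, ∀ y, ‖u s y‖ ≤ M := fun s hs =>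
    exists_norm_le_of_hasUniformRapidDecayOn_of_eq_biotSavart2D h.smooth_velocity hω hBS hs
  -- the `L⁴` level at time `t`
  have hL4 := h.integral_pow_four_planarVorticity_le_of_integral_abs_le hS hν hcurl hω hbdd ht₀ ht
    htt hm
  rw [← hCg, ← hs2] at hL4
  -- the slice at time `t`: continuous, integrable, in `L⁴`
  have hU : UniqueDiffOn ℝ S := uniqueDiffOn_convex hS ⟨(t₀ + t) / 2, interior_mono
    (hS.ordConnected.out ht₀ ht) (by rw [interior_Icc]; exact ⟨by linarith, by linarith⟩)⟩
  obtain ⟨C, hC0, hC⟩ := hω.norm_le_rpow 3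
  set w : EuclideanSpace ℝ (Fin 2) → ℝ := PlanarEigenmode.vorticity (u t) with hw_def
  have hwc : Continuous w :=
    continuous_planarVorticity (contDiff_infty.1 (h.smooth_velocity.contDiff_slice ht) 1)
  have hw3 : ∀ y, |w y| ≤ C * (1 + ‖y‖) ^ (-((3 : ℕ) : ℝ)) := fun y => by
    have h1 := hC t ht y; rwa [Real.norm_eq_abs] at h1
  have hwB : ∀ y, |w y| ≤ C := fun y =>
    (hw3 y).trans (mul_le_of_le_one_right hC0 (rpow_neg_le_one y (by norm_num)))
  have hr3 : (Module.finrank ℝ (EuclideanSpace ℝ (Fin 2)) : ℝ) < ((3 : ℕ) : ℝ) := by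
    rw [finrank_euclideanSpace_fin]; norm_num
  have hwi : Integrable w := integrable_of_norm_le_rpow_neg hwc hr3 fun y => by
    rw [Real.norm_eq_abs]; exact hw3 y
  have hw4 : Integrable fun y => w y ^ 4 := by
    refine integrable_of_norm_le_rpow_neg (hwc.pow 4) (C := C ^ 3 * C) hr3 fun y => ?_
    rw [Real.norm_eq_abs, abs_pow, show (4 : ℕ) = 3 + 1 from rfl, pow_succ, mul_assoc]
    exact mul_le_mul (pow_le_pow_left₀ (abs_nonneg _) (hwB y) 3) (hw3 y) (abs_nonneg _)
      (pow_nonneg hC0 3)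
  -- Gallay–Wayne 2002 Lemma 2.1 (b) at radius `s`
  have hGW := norm_biotSavart2D_le_of_radius_L4 hwc hwi hw4 hs x
  rw [← hBS t ht x] at hGW
  -- `(∫ ω⁴)^{1/4} ≤ K₂ m s^{-3/2}`
  have hQ : (∫ y, w y ^ 4) ^ (1 / 4 : ℝ) ≤ K₂ * m * s ^ (-(3 / 2) : ℝ) := by
    have h0 : 0 ≤ ∫ y, w y ^ 4 := integral_nonneg fun y => by positivity
    have h1 : (∫ y, w y ^ 4) ^ (1 / 4 : ℝ) ≤ (128 / 3 * Cg ^ 3 * m ^ 4 / (s ^ 2) ^ 3) ^ (1 / 4 : ℝ) :=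
      Real.rpow_le_rpow h0 hL4 (by norm_num)
    have root4 : ∀ X : ℝ, 0 ≤ X → (X ^ 4) ^ (1 / 4 : ℝ) = X := fun X hX => by
      rw [show (1 / 4 : ℝ) = ((4 : ℕ) : ℝ)⁻¹ by norm_num]
      exact Real.pow_rpow_inv_natCast hX (by norm_num)
    rw [bound_eq_pow_four hs hCg0, ← hK₂, root4 _ (by positivity)] at h1
    exact h1
  have hm1 : ∫ y, |w y| ≤ m := hm t (right_mem_Icc.2 htt.le)
  -- assemble
  have hπ : 0 < (2 * Real.pi)⁻¹ := by positivity
  have hA0 : 0 ≤ (3 * Real.pi * s ^ (2 / 3 : ℝ)) ^ (3 / 4 : ℝ) := Real.rpow_nonneg (by positivity) _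
  calc ‖u t x‖ ≤ (2 * Real.pi)⁻¹ * ((3 * Real.pi * s ^ (2 / 3 : ℝ)) ^ (3 / 4 : ℝ) *
        (∫ y, w y ^ 4) ^ (1 / 4 : ℝ) + s⁻¹ * ∫ y, |w y|) := hGW
    _ ≤ (2 * Real.pi)⁻¹ * ((3 * Real.pi * s ^ (2 / 3 : ℝ)) ^ (3 / 4 : ℝ) *
        (K₂ * m * s ^ (-(3 / 2) : ℝ)) + s⁻¹ * m) := by
        gcongr
    _ = (2 * Real.pi)⁻¹ * ((3 * Real.pi) ^ (3 / 4 : ℝ) * K₂ + 1) * m / s := by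
        have e := radius_algebra hs hK₂0 hm0 (K₂ := K₂)
        have root4 : ∀ X : ℝ, 0 ≤ X → (X ^ 4) ^ (1 / 4 : ℝ) = X := fun X hX => by
          rw [show (1 / 4 : ℝ) = ((4 : ℕ) : ℝ)⁻¹ by norm_num]
          exact Real.pow_rpow_inv_natCast hX (by norm_num)
        rw [root4 _ (by positivity)] at e
        rw [e]
        field_simp

/-- **Non-negative vorticity: `‖u(t)‖_∞ ≤ K Γ (ν (t − t₀))^{-1/2}`.** In the setting of
`norm_le_of_integral_abs_le` with `ω(t₀) ≥ 0`, the running `L¹` bound is the conserved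
circulation `Γ = ∫ ω(t₀)` (`integral_abs_planarVorticity_eq_of_nonneg`), so for every later
`t ∈ S` and every `x`: `‖u(t, x)‖ ≤ (2π)⁻¹ ((3π)^{3/4} ((128/3) C_GNS³)^{1/4} + 1) Γ/(ν (t − t₀))^{1/2}`
— uniform in space, decaying in time, by the circulation alone (compare the tree's
`norm_le_two_mul_sqrt_of_planarVorticity_nonneg`: `2 (A Γ/2π)^{1/2}` by the initial PEAK `A`).
[cite: GallayWayne2002, Lemma 2.1 (b) (p = 1, q = 4); GallayWayne2005, Thm. 1.1 eq. (1.2) (p = 4)] -/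
theorem IsClassicalNSSolutionOn.norm_le_of_planarVorticity_nonneg_of_lt
    (h : IsClassicalNSSolutionOn S ν f u p) (hS : Convex ℝ S) (hν : 0 < ν)
    (hcurl : ∀ t ∈ S, ∀ x, PlanarEigenmode.vorticity (f t) x = 0)
    (hω : HasUniformRapidDecayOn S (fun t x => PlanarEigenmode.vorticity (u t) x))
    (hBS : ∀ t ∈ S, ∀ x, u t x = biotSavart2D (PlanarEigenmode.vorticity (u t)) x) {t₀ t : ℝ}
    (ht₀ : t₀ ∈ S) (h0 : ∀ x, 0 ≤ PlanarEigenmode.vorticity (u t₀) x) (ht : t ∈ S) (htt : t₀ < t)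
    (x : EuclideanSpace ℝ (Fin 2)) :
    ‖u t x‖ ≤ (2 * Real.pi)⁻¹ * ((3 * Real.pi) ^ (3 / 4 : ℝ) *
        (128 / 3 * (lintegralPowLePowLIntegralFDerivConst
          (volume : Measure (EuclideanSpace ℝ (Fin 2))) 2 : ℝ) ^ 3) ^ (1 / 4 : ℝ) + 1) *
      (∫ y, PlanarEigenmode.vorticity (u t₀) y) / Real.sqrt (ν * (t - t₀)) := by
  have hbdd : ∀ s ∈ S, ∃ M : ℝ, ∀ y, ‖u s y‖ ≤ M := fun s hs =>
    exists_norm_le_of_hasUniformRapidDecayOn_of_eq_biotSavart2D h.smooth_velocity hω hBS hs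
  exact h.norm_le_of_integral_abs_le hS hν hcurl hω hBS ht₀ ht htt
    (fun _ hs => ((h.integral_abs_planarVorticity_eq_of_nonneg hS hν.le hcurl hω hbdd ht₀ h0
      (hS.ordConnected.out ht₀ ht hs) hs.1).2).le) x

/-- **Signed vorticity (v3): `‖u(t)‖_∞ ≤ K ‖ω(t₀)‖₁ (ν (t − t₀))^{-1/2}`.** In the setting of
`norm_le_of_integral_abs_le`, the running `L¹` bound holds with `m = ‖ω(t₀)‖₁` by the `L¹`
contraction (`integral_abs_planarVorticity_le`), so for every later `t ∈ S` and every `x`: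
`‖u(t, x)‖ ≤ (2π)⁻¹ ((3π)^{3/4} ((128/3) C_GNS³)^{1/4} + 1) ‖ω(t₀)‖₁/(ν (t − t₀))^{1/2}`.
[cite: GallayWayne2002, Lemma 2.1 (b) (p = 1, q = 4); GallayWayne2005, Thm. 1.1 eq. (1.2)] -/
theorem IsClassicalNSSolutionOn.norm_le_of_lt
    (h : IsClassicalNSSolutionOn S ν f u p) (hS : Convex ℝ S) (hν : 0 < ν)
    (hcurl : ∀ t ∈ S, ∀ x, PlanarEigenmode.vorticity (f t) x = 0)
    (hω : HasUniformRapidDecayOn S (fun t x => PlanarEigenmode.vorticity (u t) x))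
    (hBS : ∀ t ∈ S, ∀ x, u t x = biotSavart2D (PlanarEigenmode.vorticity (u t)) x) {t₀ t : ℝ}
    (ht₀ : t₀ ∈ S) (ht : t ∈ S) (htt : t₀ < t) (x : EuclideanSpace ℝ (Fin 2)) :
    ‖u t x‖ ≤ (2 * Real.pi)⁻¹ * ((3 * Real.pi) ^ (3 / 4 : ℝ) *
        (128 / 3 * (lintegralPowLePowLIntegralFDerivConst
          (volume : Measure (EuclideanSpace ℝ (Fin 2))) 2 : ℝ) ^ 3) ^ (1 / 4 : ℝ) + 1) *
      (∫ y, |PlanarEigenmode.vorticity (u t₀) y|) / Real.sqrt (ν * (t - t₀)) := by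
  have hbdd : ∀ s ∈ S, ∃ M : ℝ, ∀ y, ‖u s y‖ ≤ M := fun s hs =>
    exists_norm_le_of_hasUniformRapidDecayOn_of_eq_biotSavart2D h.smooth_velocity hω hBS hs
  exact h.norm_le_of_integral_abs_le hS hν hcurl hω hBS ht₀ ht htt (fun _ hs =>
    h.integral_abs_planarVorticity_le hS hν.le hcurl hω hbdd ht₀ (hS.ordConnected.out ht₀ ht hs) hs.1) x

end Planar

/-! ### §3 (v4) The sharp-kernel route with explicit constants -/

section PlanarSharp

variable {S : Set ℝ} {ν : ℝ} {f u : ℝ → EuclideanSpace ℝ (Fin 2) → EuclideanSpace ℝ (Fin 2)}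
  {p : ℝ → EuclideanSpace ℝ (Fin 2) → ℝ}

/-- **Signed data, explicit: `‖u(t, x)‖ ≤ m (2πν(t − t₀))^{-1/2}`.** Let `(u, p)` be a classical
planar Navier–Stokes solution on a convex time set `S` (`ν > 0`, curl-free force, uniformly rapidly
decaying vorticity, `u = K₂ ∗ ω`) with `‖ω(s)‖₁ ≤ m` on `[t₀, t]` (`t₀ < t`). Then for every `x`,
`‖u(t, x)‖ ≤ m / (2π ν (t − t₀))^{1/2}`: the explicit `L^∞` smoothing bound
`‖ω(t)‖_∞ ≤ m/(ν(t − t₀))` (`abs_planarVorticity_le_of_integral_abs_le_explicit`, Nash constant `1/8`)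
in the sharp kinematic bound `‖K₂ ∗ ω‖ ≤ (‖ω‖_∞‖ω‖₁/2π)^{1/2}` (`norm_biotSavart2D_le_sqrt_of_abs_le`).
Compare `norm_le_of_integral_abs_le` (`K(C_GNS)·m(ν(t−t₀))^{-1/2}` via the `L⁴` level).
[cite: GallayWayne2005, Thm. 1.1 eq. (1.2) (p = ∞); IftimieSiderisGamblin1999, Lemma 2.1; GallayWayne2002, Lemma 2.1 (b)] -/
theorem IsClassicalNSSolutionOn.norm_le_div_sqrt_of_integral_abs_le
    (h : IsClassicalNSSolutionOn S ν f u p) (hS : Convex ℝ S) (hν : 0 < ν)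
    (hcurl : ∀ t ∈ S, ∀ x, PlanarEigenmode.vorticity (f t) x = 0)
    (hω : HasUniformRapidDecayOn S (fun t x => PlanarEigenmode.vorticity (u t) x))
    (hBS : ∀ t ∈ S, ∀ x, u t x = biotSavart2D (PlanarEigenmode.vorticity (u t)) x) {t₀ t : ℝ}
    (ht₀ : t₀ ∈ S) (ht : t ∈ S) (htt : t₀ < t) {m : ℝ}
    (hm : ∀ s ∈ Icc t₀ t, ∫ x, |PlanarEigenmode.vorticity (u s) x| ≤ m)
    (x : EuclideanSpace ℝ (Fin 2)) :
    ‖u t x‖ ≤ m / Real.sqrt (2 * Real.pi * ν * (t - t₀)) := by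
  have hπ : 0 < Real.pi := Real.pi_pos
  have hτ : 0 < ν * (t - t₀) := mul_pos hν (sub_pos.2 htt)
  have hm1 : ∫ y, |PlanarEigenmode.vorticity (u t) y| ≤ m := hm t (right_mem_Icc.2 htt.le)
  have hm0 : 0 ≤ m := (integral_nonneg fun y => abs_nonneg _).trans hm1
  have hbdd : ∀ s ∈ S, ∃ M : ℝ, ∀ y, ‖u s y‖ ≤ M := fun s hs =>
    exists_norm_le_of_hasUniformRapidDecayOn_of_eq_biotSavart2D h.smooth_velocity hω hBS hs
  -- the slice at time `t`: continuous, integrable, bounded by `m/(ν(t − t₀))`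
  obtain ⟨C, hC0, hC⟩ := hω.norm_le_rpow 3
  have hwc : Continuous (PlanarEigenmode.vorticity (u t)) :=
    continuous_planarVorticity (contDiff_infty.1 (h.smooth_velocity.contDiff_slice ht) 1)
  have hr3 : (Module.finrank ℝ (EuclideanSpace ℝ (Fin 2)) : ℝ) < ((3 : ℕ) : ℝ) := by
    rw [finrank_euclideanSpace_fin]; norm_num
  have hwi : Integrable (PlanarEigenmode.vorticity (u t)) :=
    integrable_of_norm_le_rpow_neg hwc hr3 fun y => hC t ht y
  have hA : ∀ y, |PlanarEigenmode.vorticity (u t) y| ≤ m / (ν * (t - t₀)) := fun y =>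
    h.abs_planarVorticity_le_of_integral_abs_le_explicit hS hν hcurl hω hbdd ht₀ ht htt hm y
  have hsharp := norm_biotSavart2D_le_sqrt_of_abs_le hwi hA x
  rw [← hBS t ht x] at hsharp
  refine hsharp.trans ?_
  have hA0 : 0 ≤ m / (ν * (t - t₀)) := by positivity
  calc Real.sqrt (m / (ν * (t - t₀)) * (∫ y, |PlanarEigenmode.vorticity (u t) y|) / (2 * Real.pi))
      ≤ Real.sqrt (m / (ν * (t - t₀)) * m / (2 * Real.pi)) :=
        Real.sqrt_le_sqrt (div_le_div_of_nonneg_right (mul_le_mul_of_nonneg_left hm1 hA0)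
          (by positivity))
    _ = m / Real.sqrt (2 * Real.pi * ν * (t - t₀)) := by
        rw [show m / (ν * (t - t₀)) * m / (2 * Real.pi) = m ^ 2 / (2 * Real.pi * ν * (t - t₀)) by
          field_simp, Real.sqrt_div (sq_nonneg m), Real.sqrt_sq hm0]

/-- **Non-negative vorticity, explicit and sharp-kernel: `‖u(t, x)‖ ≤ Γ (4πν(t − t₀))^{-1/2}`.**
In the setting of `norm_le_div_sqrt_of_integral_abs_le` with `ω(t₀) ≥ 0` and `Γ = ∫ ω(t₀)`: for every
later `t ∈ S` and every `x`, `‖u(t, x)‖ ≤ Γ / (4π ν (t − t₀))^{1/2}` — the explicit peak bound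
`0 ≤ ω(t) ≤ Γ/(ν(t − t₀))` (`planarVorticity_le_of_nonneg_explicit`), Kelvin `∫ω(t) = Γ`
(`planarVorticity_moments_eq`), and the SHARP co-signed kinematic bound
`‖K₂ ∗ ω‖ ≤ (‖ω‖_∞ Γ/4π)^{1/2}` (`norm_biotSavart2D_le_sqrt_of_nonneg`). The Lamb–Oseen vortex of
circulation `Γ` has maximal speed `≈ 0.0451 Γ (ν t)^{-1/2}`; here `(4π)^{-1/2} ≈ 0.2821`.
[cite: GallayWayne2005, Thm. 1.1 eq. (1.2) (p = ∞); IftimieSiderisGamblin1999, Lemma 2.1; MajdaBertozziCUP2002, §1.7 Prop. 1.14 (i)] -/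
theorem IsClassicalNSSolutionOn.norm_le_div_sqrt_of_planarVorticity_nonneg_of_lt
    (h : IsClassicalNSSolutionOn S ν f u p) (hS : Convex ℝ S) (hν : 0 < ν)
    (hcurl : ∀ t ∈ S, ∀ x, PlanarEigenmode.vorticity (f t) x = 0)
    (hω : HasUniformRapidDecayOn S (fun t x => PlanarEigenmode.vorticity (u t) x))
    (hBS : ∀ t ∈ S, ∀ x, u t x = biotSavart2D (PlanarEigenmode.vorticity (u t)) x) {t₀ t : ℝ}
    (ht₀ : t₀ ∈ S) (h0 : ∀ x, 0 ≤ PlanarEigenmode.vorticity (u t₀) x) (ht : t ∈ S) (htt : t₀ < t)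
    (x : EuclideanSpace ℝ (Fin 2)) :
    ‖u t x‖ ≤ (∫ y, PlanarEigenmode.vorticity (u t₀) y) / Real.sqrt (4 * Real.pi * ν * (t - t₀)) := by
  have hπ : 0 < Real.pi := Real.pi_pos
  have hτ : 0 < ν * (t - t₀) := mul_pos hν (sub_pos.2 htt)
  set Γ : ℝ := ∫ y, PlanarEigenmode.vorticity (u t₀) y with hΓ_def
  have hΓ0 : 0 ≤ Γ := integral_nonneg h0
  have hbdd : ∀ s ∈ S, ∃ M : ℝ, ∀ y, ‖u s y‖ ≤ M := fun s hs =>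
    exists_norm_le_of_hasUniformRapidDecayOn_of_eq_biotSavart2D h.smooth_velocity hω hBS hs
  obtain ⟨C, hC0, hC⟩ := hω.norm_le_rpow 3
  have hwc : Continuous (PlanarEigenmode.vorticity (u t)) :=
    continuous_planarVorticity (contDiff_infty.1 (h.smooth_velocity.contDiff_slice ht) 1)
  have hr3 : (Module.finrank ℝ (EuclideanSpace ℝ (Fin 2)) : ℝ) < ((3 : ℕ) : ℝ) := by
    rw [finrank_euclideanSpace_fin]; norm_num
  have hwi : Integrable (PlanarEigenmode.vorticity (u t)) :=
    integrable_of_norm_le_rpow_neg hwc hr3 fun y => hC t ht y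
  have hlohi := fun y =>
    h.planarVorticity_le_of_nonneg_explicit hS hν hcurl hω hbdd ht₀ h0 ht htt y
  have hflux : ∫ y, PlanarEigenmode.vorticity (u t) y = Γ :=
    (h.planarVorticity_moments_eq hS hω hBS hcurl ht₀ ht 0).1
  have hsharp := norm_biotSavart2D_le_sqrt_of_nonneg hwi (fun y => (hlohi y).1)
    (fun y => (hlohi y).2) x
  rw [← hBS t ht x, hflux] at hsharp
  refine hsharp.trans (le_of_eq ?_)
  rw [show Γ / (ν * (t - t₀)) * Γ / (4 * Real.pi) = Γ ^ 2 / (4 * Real.pi * ν * (t - t₀)) by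
    field_simp, Real.sqrt_div (sq_nonneg Γ), Real.sqrt_sq hΓ0]

/-- **Signed data, explicit: `‖u(t, x)‖ ≤ ‖ω(t₀)‖₁ (2πν(t − t₀))^{-1/2}`** — the running `L¹` bound
of `norm_le_div_sqrt_of_integral_abs_le` fed by the `L¹` contraction (`integral_abs_planarVorticity_le`).
[cite: GallayWayne2005, Thm. 1.1 eq. (1.2); IftimieSiderisGamblin1999, Lemma 2.1] -/
theorem IsClassicalNSSolutionOn.norm_le_div_sqrt_of_lt
    (h : IsClassicalNSSolutionOn S ν f u p) (hS : Convex ℝ S) (hν : 0 < ν)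
    (hcurl : ∀ t ∈ S, ∀ x, PlanarEigenmode.vorticity (f t) x = 0)
    (hω : HasUniformRapidDecayOn S (fun t x => PlanarEigenmode.vorticity (u t) x))
    (hBS : ∀ t ∈ S, ∀ x, u t x = biotSavart2D (PlanarEigenmode.vorticity (u t)) x) {t₀ t : ℝ}
    (ht₀ : t₀ ∈ S) (ht : t ∈ S) (htt : t₀ < t) (x : EuclideanSpace ℝ (Fin 2)) :
    ‖u t x‖ ≤ (∫ y, |PlanarEigenmode.vorticity (u t₀) y|) / Real.sqrt (2 * Real.pi * ν * (t - t₀)) := by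
  have hbdd : ∀ s ∈ S, ∃ M : ℝ, ∀ y, ‖u s y‖ ≤ M := fun s hs =>
    exists_norm_le_of_hasUniformRapidDecayOn_of_eq_biotSavart2D h.smooth_velocity hω hBS hs
  exact h.norm_le_div_sqrt_of_integral_abs_le hS hν hcurl hω hBS ht₀ ht htt (fun _ hs =>
    h.integral_abs_planarVorticity_le hS hν.le hcurl hω hbdd ht₀ (hS.ordConnected.out ht₀ ht hs) hs.1) x

end PlanarSharp

/-! ### §2 The swirl of Lundgren's stretched tube: the Burgers-scale ceiling, uniform in time -/

namespace Lundgren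

open StrainedAzimuthal TwoAndAHalfD

section SwirlCeiling

open MeasureTheory PlanarEigenmode InviscidShear

variable {S S' : Set ℝ} {ν : ℝ} {γ a τ d : ℝ → ℝ}
  {v : ℝ → EuclideanSpace ℝ (Fin 2) → EuclideanSpace ℝ (Fin 2)}
  {q : ℝ → EuclideanSpace ℝ (Fin 2) → ℝ} {w : ℝ → EuclideanSpace ℝ (Fin 2) → ℝ}

/-- The scalar vorticity of the zero planar field vanishes. [folklore] -/
private theorem planarVorticity_zero_force' (σ : ℝ) (η : EuclideanSpace ℝ (Fin 2)) :
    PlanarEigenmode.vorticity ((0 : ℝ → EuclideanSpace ℝ (Fin 2) → EuclideanSpace ℝ (Fin 2)) σ) η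
      = 0 := by
  rw [Pi.zero_apply, PlanarEigenmode.vorticity_def,
    show (0 : EuclideanSpace ℝ (Fin 2) → EuclideanSpace ℝ (Fin 2)) = fun _ => 0 from rfl]
  simp

/-- **The swirl speed of Lundgren's stretched tube is bounded by the circulation and the elapsed
Lundgren time — with NO dependence on the initial peak.** Let `(ṽ, p̃)` be a classical planar
Navier–Stokes solution (`ν > 0`, unforced) on a convex Lundgren-time set `S̃`, with uniformly
rapidly decaying vorticity and `ṽ = K₂ ∗ ω̃`; clocks `a, τ` with `τ(S) ⊆ S̃`; times `t₀, t ∈ S`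
with `τ(t₀) < τ(t)`, `a(t₀) ≠ 0`. If the axial vorticity of the stretched flow
`γDx + aṽ(τ, a x̃) + dW̃(τ, a x̃)e_z` is NON-NEGATIVE on `ℝ³` at time `t₀`, with cross-section
circulation `Γ = ∫ ω_z(t₀, ιy + z₀e_z) dy`, then its swirl part satisfies, everywhere,
`‖a(t) ṽ(τ(t), a(t) y)‖ ≤ |a(t)| · K Γ / (ν (τ(t) − τ(t₀)))^{1/2}`,
`K = (2π)⁻¹((3π)^{3/4}((128/3) C_GNS³)^{1/4} + 1)`: Saffman (29) composed with the planar decay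
`norm_le_of_planarVorticity_nonneg_of_lt` along (28) (Gallay–Wayne smoothing + Kelvin).
[cite: Saffman1992, §13.3 eqs. (28)–(29)] [cite: GallayWayne2005, Thm. 1.1 eq. (1.2)] [cite: GallayWayne2002, Lemma 2.1 (b)] -/
theorem norm_swirl_lundgren_le_of_circulation (hS' : Convex ℝ S') (hν : 0 < ν)
    (hv : IsClassicalNSSolutionOn S' ν 0 v q)
    (hω : HasUniformRapidDecayOn S' (fun σ η => PlanarEigenmode.vorticity (v σ) η))
    (hBS : ∀ σ ∈ S', ∀ η, v σ η = biotSavart2D (PlanarEigenmode.vorticity (v σ)) η)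
    (hw : IsSmoothSpaceTimeOn S' w) (hmaps : MapsTo τ S S') {t₀ t : ℝ} (ht₀ : t₀ ∈ S) (ht : t ∈ S)
    (hτ : τ t₀ < τ t) (ha₀ : a t₀ ≠ 0)
    (hpos : ∀ x : EuclideanSpace ℝ (Fin 3), 0 ≤ curl (velocity γ (fun t y => a t • v (τ t) (a t • y))
      (fun t y => d t • w (τ t) (a t • y)) t₀) x 2)
    (z₀ : ℝ) (y : EuclideanSpace ℝ (Fin 2)) :
    ‖a t • v (τ t) (a t • y)‖ ≤
      |a t| * ((2 * Real.pi)⁻¹ * ((3 * Real.pi) ^ (3 / 4 : ℝ) *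
        (128 / 3 * (lintegralPowLePowLIntegralFDerivConst
          (volume : Measure (EuclideanSpace ℝ (Fin 2))) 2 : ℝ) ^ 3) ^ (1 / 4 : ℝ) + 1) *
        (∫ y' : EuclideanSpace ℝ (Fin 2), curl (velocity γ (fun t y => a t • v (τ t) (a t • y))
          (fun t y => d t • w (τ t) (a t • y)) t₀) (embedXY y' + z₀ • eZ) 2) /
        Real.sqrt (ν * (τ t - τ t₀))) := by
  have ha2 : 0 < a t₀ ^ 2 := by positivity
  -- the planar vorticity at Lundgren time `τ t₀` is non-negative
  have hplanar : ∀ η : EuclideanSpace ℝ (Fin 2),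
      PlanarEigenmode.vorticity (v (τ t₀)) η =
        curl (velocity γ (fun t y => a t • v (τ t) (a t • y)) (fun t y => d t • w (τ t) (a t • y)) t₀)
          (embedXY ((a t₀)⁻¹ • η)) 2 / a t₀ ^ 2 := by
    intro η
    rw [curl_lundgren_apply_two hv.smooth_velocity hw hmaps ht₀, projXY_embedXY, smul_smul,
      mul_inv_cancel₀ ha₀, one_smul, mul_div_cancel_left₀ _ ha2.ne']
  have h0 : ∀ η, 0 ≤ PlanarEigenmode.vorticity (v (τ t₀)) η := fun η => by
    rw [hplanar η]; exact div_nonneg (hpos _) ha2.le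
  -- the planar decay at Lundgren time `τ t`, read through Saffman (29)
  have hb := hv.norm_le_of_planarVorticity_nonneg_of_lt hS' hν (fun σ _ η => planarVorticity_zero_force' σ η)
    hω hBS (hmaps ht₀) h0 (hmaps ht) hτ (a t • y)
  rw [← integral_curl_lundgren_crossSection hv.smooth_velocity hw hmaps ht₀ ha₀ z₀] at hb
  rw [norm_smul, Real.norm_eq_abs]
  exact mul_le_mul_of_nonneg_left hb (abs_nonneg _)

/-- `e^{ct/2}² = e^{ct}`. [folklore] -/
private theorem exp_half_sq' (c t : ℝ) : Real.exp (c * t / 2) ^ 2 = Real.exp (c * t) := by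
  rw [sq, ← Real.exp_add]; ring_nf

/-- The stretch factor against the Lundgren clock at constant strain:
`e^{ct/2} / (ν (e^{ct} − e^{ct₀})/c)^{1/2} = (c / (ν (1 − e^{−c(t−t₀)})))^{1/2}`. [folklore] -/
private theorem exp_half_div_sqrt_clock {c ν t₀ t : ℝ} (hc : 0 < c) (hν : 0 < ν) (htt : t₀ < t) :
    Real.exp (c * t / 2) / Real.sqrt (ν * ((Real.exp (c * t) - 1) / c - (Real.exp (c * t₀) - 1) / c)) =
      Real.sqrt (c / (ν * (1 - Real.exp (-(c * (t - t₀)))))) := by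
  have hE : 0 < Real.exp (c * t) := Real.exp_pos _
  have hlt : Real.exp (-(c * (t - t₀))) < 1 :=
    Real.exp_lt_one_iff.2 (by nlinarith)
  have hden : 0 < 1 - Real.exp (-(c * (t - t₀))) := by linarith
  have hclock : (Real.exp (c * t) - 1) / c - (Real.exp (c * t₀) - 1) / c =
      Real.exp (c * t) * (1 - Real.exp (-(c * (t - t₀)))) / c := by
    rw [show -(c * (t - t₀)) = c * t₀ - c * t by ring, Real.exp_sub]
    field_simp
    ring
  rw [hclock, ← Real.sqrt_sq (Real.exp_pos (c * t / 2)).le, exp_half_sq', ← Real.sqrt_div' _ ]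
  · congr 1
    field_simp
  · positivity

/-- **CONSTANT STRAIN RATE `c > 0`: THE SWIRL SPEED SATURATES AT THE BURGERS SCALE `Γ (c/ν)^{1/2}`,
UNIFORMLY IN TIME.** For Lundgren's stretched tube with clocks `a = e^{ct/2}`, `τ = (e^{ct} − 1)/c`,
`d = e^{−ct}` carrying ANY planar cross-section (classical, unforced, `ν > 0`, uniformly rapidly
decaying non-negative axial vorticity, `ṽ = K₂ ∗ ω̃`) and `t₀ < t` in `S`:
`‖e^{ct/2} ṽ(τ(t), e^{ct/2} y)‖ ≤ K · Γ · (c / (ν (1 − e^{−c(t − t₀)})))^{1/2}` for every `y`, with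
`K = (2π)⁻¹((3π)^{3/4}((128/3) C_GNS³)^{1/4} + 1)` and `Γ` the cross-section circulation — a
CEILING of the same Burgers size `Γ (c/ν)^{1/2}` as the tree's FLOOR after the compaction budget,
`integral_curl_lundgren_const_swirl_floor_of_budget` (`U ≥ (Γ/8π)(c/ρν)^{1/2}`); after one strain
time the ceiling is within the factor `(1 − e^{−1})^{−1/2} < 1.26` of its limit. Compare
`norm_swirl_lundgren_le_sqrt`, which grows like the stretch `e^{c(t−t₀)/2}`.
[cite: Saffman1992, §13.3 eqs. (28)–(31)] [cite: GallayWayne2005, Thm. 1.1 eq. (1.2)] [cite: GallayWayne2002, Lemma 2.1 (b)] -/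
theorem norm_swirl_lundgren_const_le_of_circulation {c : ℝ} (hc : 0 < c) (hS' : Convex ℝ S')
    (hν : 0 < ν) (hv : IsClassicalNSSolutionOn S' ν 0 v q)
    (hω : HasUniformRapidDecayOn S' (fun σ η => PlanarEigenmode.vorticity (v σ) η))
    (hBS : ∀ σ ∈ S', ∀ η, v σ η = biotSavart2D (PlanarEigenmode.vorticity (v σ)) η)
    (hw : IsSmoothSpaceTimeOn S' w) (hmaps : MapsTo (fun t => (Real.exp (c * t) - 1) / c) S S')
    {t₀ t : ℝ} (ht₀ : t₀ ∈ S) (ht : t ∈ S) (htt : t₀ < t)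
    (hpos : ∀ x : EuclideanSpace ℝ (Fin 3),
      0 ≤ curl (velocity (fun _ => c)
          (fun t y =>
            Real.exp (c * t / 2) • v ((Real.exp (c * t) - 1) / c) (Real.exp (c * t / 2) • y))
          (fun t y =>
            Real.exp (-(c * t)) • w ((Real.exp (c * t) - 1) / c) (Real.exp (c * t / 2) • y)) t₀)
          x 2)
    (z₀ : ℝ) (y : EuclideanSpace ℝ (Fin 2)) :
    ‖Real.exp (c * t / 2) • v ((Real.exp (c * t) - 1) / c) (Real.exp (c * t / 2) • y)‖ ≤
      (2 * Real.pi)⁻¹ * ((3 * Real.pi) ^ (3 / 4 : ℝ) *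
        (128 / 3 * (lintegralPowLePowLIntegralFDerivConst
          (volume : Measure (EuclideanSpace ℝ (Fin 2))) 2 : ℝ) ^ 3) ^ (1 / 4 : ℝ) + 1) *
        (∫ y' : EuclideanSpace ℝ (Fin 2), curl (velocity (fun _ => c)
          (fun t y =>
            Real.exp (c * t / 2) • v ((Real.exp (c * t) - 1) / c) (Real.exp (c * t / 2) • y))
          (fun t y =>
            Real.exp (-(c * t)) • w ((Real.exp (c * t) - 1) / c) (Real.exp (c * t / 2) • y)) t₀)
          (embedXY y' + z₀ • eZ) 2) *
        Real.sqrt (c / (ν * (1 - Real.exp (-(c * (t - t₀)))))) := by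
  have hτ : (Real.exp (c * t₀) - 1) / c < (Real.exp (c * t) - 1) / c := by
    refine div_lt_div_of_pos_right ?_ hc
    exact sub_lt_sub_right (Real.exp_lt_exp.2 (mul_lt_mul_of_pos_left htt hc)) 1
  have h := norm_swirl_lundgren_le_of_circulation (γ := fun _ => c) (a := fun t => Real.exp (c * t / 2))
    (τ := fun t => (Real.exp (c * t) - 1) / c) (d := fun t => Real.exp (-(c * t))) hS' hν hv hω hBS hw
    hmaps ht₀ ht hτ (Real.exp_pos _).ne' hpos z₀ y
  rw [abs_of_pos (Real.exp_pos _)] at h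
  refine h.trans (le_of_eq ?_)
  rw [← exp_half_div_sqrt_clock hc hν htt]
  ring

/-- The stretch against the Lundgren clock at constant strain:
`e^{ct} / (ν ((e^{ct} − 1)/c − (e^{ct₀} − 1)/c)) = c / (ν (1 − e^{−c(t−t₀)}))`. [folklore] -/
private theorem exp_div_clock {c ν t₀ t : ℝ} (hc : 0 < c) (hν : 0 < ν) (htt : t₀ < t) :
    Real.exp (c * t) / (ν * ((Real.exp (c * t) - 1) / c - (Real.exp (c * t₀) - 1) / c)) =
      c / (ν * (1 - Real.exp (-(c * (t - t₀))))) := by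
  have hE : 0 < Real.exp (c * t) := Real.exp_pos _
  have hlt : Real.exp (-(c * (t - t₀))) < 1 := Real.exp_lt_one_iff.2 (by nlinarith)
  have hden : 0 < 1 - Real.exp (-(c * (t - t₀))) := by linarith
  have hclock : (Real.exp (c * t) - 1) / c - (Real.exp (c * t₀) - 1) / c =
      Real.exp (c * t) * (1 - Real.exp (-(c * (t - t₀)))) / c := by
    rw [show -(c * (t - t₀)) = c * t₀ - c * t by ring, Real.exp_sub]
    field_simp
    ring
  rw [hclock]
  field_simp

/-- **The axial vorticity of Lundgren's stretched tube is bounded by the circulation, the stretch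
and the elapsed Lundgren time — with NO dependence on the initial peak** (v2). In the setting of
`norm_swirl_lundgren_le_of_circulation` (co-signed cross-section at time `t₀`, circulation `Γ`),
for `τ(t₀) < τ(t)` and every `x ∈ ℝ³`:
`0 ≤ ω_z(t, x) ≤ a(t)² · 8 C_GNS Γ / (ν (τ(t) − τ(t₀)))` — Saffman (29)
(`ω_z(t, x) = a(t)² ω̃(τ(t), a(t)x̃)`) with the planar `L^∞` smoothing bound
`‖ω̃(τ)‖_∞ ≤ 8 C_GNS Γ/(ν (τ − τ₀))` (`IsClassicalNSSolutionOn.planarVorticity_le_of_nonneg`, the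
Nash–Moser iteration) and the minimum principle.
[cite: Saffman1992, §13.3 eqs. (28)–(29)] [cite: GallayWayne2005, Thm. 1.1 eq. (1.2) (p = ∞)] [cite: CarlenLoss1995, Thm. 1] -/
theorem curl_lundgren_le_of_circulation (hS' : Convex ℝ S') (hν : 0 < ν)
    (hv : IsClassicalNSSolutionOn S' ν 0 v q)
    (hω : HasUniformRapidDecayOn S' (fun σ η => PlanarEigenmode.vorticity (v σ) η))
    (hBS : ∀ σ ∈ S', ∀ η, v σ η = biotSavart2D (PlanarEigenmode.vorticity (v σ)) η)
    (hw : IsSmoothSpaceTimeOn S' w) (hmaps : MapsTo τ S S') {t₀ t : ℝ} (ht₀ : t₀ ∈ S) (ht : t ∈ S)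
    (hτ : τ t₀ < τ t) (ha₀ : a t₀ ≠ 0)
    (hpos : ∀ x : EuclideanSpace ℝ (Fin 3), 0 ≤ curl (velocity γ (fun t y => a t • v (τ t) (a t • y))
      (fun t y => d t • w (τ t) (a t • y)) t₀) x 2)
    (z₀ : ℝ) (x : EuclideanSpace ℝ (Fin 3)) :
    0 ≤ curl (velocity γ (fun t y => a t • v (τ t) (a t • y)) (fun t y => d t • w (τ t) (a t • y)) t)
        x 2 ∧
      curl (velocity γ (fun t y => a t • v (τ t) (a t • y)) (fun t y => d t • w (τ t) (a t • y)) t)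
          x 2 ≤
        a t ^ 2 * (8 * (lintegralPowLePowLIntegralFDerivConst
          (volume : Measure (EuclideanSpace ℝ (Fin 2))) 2 : ℝ) *
          (∫ y' : EuclideanSpace ℝ (Fin 2), curl (velocity γ (fun t y => a t • v (τ t) (a t • y))
            (fun t y => d t • w (τ t) (a t • y)) t₀) (embedXY y' + z₀ • eZ) 2) /
          (ν * (τ t - τ t₀))) := by
  have ha2 : 0 < a t₀ ^ 2 := by positivity
  have hplanar : ∀ η : EuclideanSpace ℝ (Fin 2),
      PlanarEigenmode.vorticity (v (τ t₀)) η =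
        curl (velocity γ (fun t y => a t • v (τ t) (a t • y)) (fun t y => d t • w (τ t) (a t • y)) t₀)
          (embedXY ((a t₀)⁻¹ • η)) 2 / a t₀ ^ 2 := by
    intro η
    rw [curl_lundgren_apply_two hv.smooth_velocity hw hmaps ht₀, projXY_embedXY, smul_smul,
      mul_inv_cancel₀ ha₀, one_smul, mul_div_cancel_left₀ _ ha2.ne']
  have h0 : ∀ η, 0 ≤ PlanarEigenmode.vorticity (v (τ t₀)) η := fun η => by
    rw [hplanar η]; exact div_nonneg (hpos _) ha2.le
  have hbdd : ∀ σ ∈ S', ∃ M : ℝ, ∀ η, ‖v σ η‖ ≤ M := fun σ hσ =>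
    exists_norm_le_of_hasUniformRapidDecayOn_of_eq_biotSavart2D hv.smooth_velocity hω hBS hσ
  have hcurl0 : ∀ σ ∈ S', ∀ η, PlanarEigenmode.vorticity
      ((0 : ℝ → EuclideanSpace ℝ (Fin 2) → EuclideanSpace ℝ (Fin 2)) σ) η = 0 :=
    fun σ _ η => planarVorticity_zero_force' σ η
  -- the planar bounds at Lundgren time `τ t`
  have hup := hv.planarVorticity_le_of_nonneg hS' hν hcurl0 hω hbdd (hmaps ht₀) h0 (hmaps ht) hτ
  have hlow := (hv.integral_abs_planarVorticity_eq_of_nonneg hS' hν.le hcurl0 hω hbdd (hmaps ht₀) h0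
    (hmaps ht) hτ.le).1
  rw [← integral_curl_lundgren_crossSection hv.smooth_velocity hw hmaps ht₀ ha₀ z₀] at hup
  rw [curl_lundgren_apply_two hv.smooth_velocity hw hmaps ht]
  exact ⟨mul_nonneg (sq_nonneg _) (hlow _), mul_le_mul_of_nonneg_left (hup _) (sq_nonneg _)⟩

/-- **CONSTANT STRAIN RATE `c > 0`: THE PEAK AXIAL VORTICITY SATURATES AT THE BURGERS SCALE
`Γ c/ν`, UNIFORMLY IN TIME** (v2). For Lundgren's stretched tube with clocks `a = e^{ct/2}`,
`τ = (e^{ct} − 1)/c`, `d = e^{−ct}` carrying ANY co-signed planar cross-section (classical,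
unforced, `ν > 0`, uniformly rapidly decaying vorticity, `ṽ = K₂ ∗ ω̃`) and `t₀ < t` in `S`:
`0 ≤ ω_z(t, x) ≤ 8 C_GNS · Γ · c / (ν (1 − e^{−c(t − t₀)}))` for every `x ∈ ℝ³` — a CEILING of
the Burgers size `Γc/ν` (Burgers' vortex has peak `Γc/(4πν)`), the companion of the tree's FLOOR
after the compaction budget `sSup ω_z(t, ·) ≥ Γc/(8πνρ)`
(`integral_curl_lundgren_const_floor_of_budget`); the earlier ceiling
`abs_curl_lundgren_const_le_exp_mul` grows like the stretch `e^{c(t−t₀)}`.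
[cite: Saffman1992, §13.3 eqs. (28)–(31)] [cite: GallayWayne2005, Thm. 1.1 eq. (1.2) (p = ∞)] [cite: CarlenLoss1995, Thm. 1] -/
theorem curl_lundgren_const_le_of_circulation {c : ℝ} (hc : 0 < c) (hS' : Convex ℝ S')
    (hν : 0 < ν) (hv : IsClassicalNSSolutionOn S' ν 0 v q)
    (hω : HasUniformRapidDecayOn S' (fun σ η => PlanarEigenmode.vorticity (v σ) η))
    (hBS : ∀ σ ∈ S', ∀ η, v σ η = biotSavart2D (PlanarEigenmode.vorticity (v σ)) η)
    (hw : IsSmoothSpaceTimeOn S' w) (hmaps : MapsTo (fun t => (Real.exp (c * t) - 1) / c) S S')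
    {t₀ t : ℝ} (ht₀ : t₀ ∈ S) (ht : t ∈ S) (htt : t₀ < t)
    (hpos : ∀ x : EuclideanSpace ℝ (Fin 3),
      0 ≤ curl (velocity (fun _ => c)
          (fun t y =>
            Real.exp (c * t / 2) • v ((Real.exp (c * t) - 1) / c) (Real.exp (c * t / 2) • y))
          (fun t y =>
            Real.exp (-(c * t)) • w ((Real.exp (c * t) - 1) / c) (Real.exp (c * t / 2) • y)) t₀)
          x 2)
    (z₀ : ℝ) (x : EuclideanSpace ℝ (Fin 3)) :
    0 ≤ curl (velocity (fun _ => c)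
          (fun t y =>
            Real.exp (c * t / 2) • v ((Real.exp (c * t) - 1) / c) (Real.exp (c * t / 2) • y))
          (fun t y =>
            Real.exp (-(c * t)) • w ((Real.exp (c * t) - 1) / c) (Real.exp (c * t / 2) • y)) t)
          x 2 ∧
      curl (velocity (fun _ => c)
          (fun t y =>
            Real.exp (c * t / 2) • v ((Real.exp (c * t) - 1) / c) (Real.exp (c * t / 2) • y))
          (fun t y =>
            Real.exp (-(c * t)) • w ((Real.exp (c * t) - 1) / c) (Real.exp (c * t / 2) • y)) t)
          x 2 ≤
        8 * (lintegralPowLePowLIntegralFDerivConst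
          (volume : Measure (EuclideanSpace ℝ (Fin 2))) 2 : ℝ) *
          (∫ y' : EuclideanSpace ℝ (Fin 2), curl (velocity (fun _ => c)
            (fun t y =>
              Real.exp (c * t / 2) • v ((Real.exp (c * t) - 1) / c) (Real.exp (c * t / 2) • y))
            (fun t y =>
              Real.exp (-(c * t)) • w ((Real.exp (c * t) - 1) / c) (Real.exp (c * t / 2) • y)) t₀)
            (embedXY y' + z₀ • eZ) 2) *
          (c / (ν * (1 - Real.exp (-(c * (t - t₀)))))) := by
  have hτ : (Real.exp (c * t₀) - 1) / c < (Real.exp (c * t) - 1) / c := by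
    refine div_lt_div_of_pos_right ?_ hc
    exact sub_lt_sub_right (Real.exp_lt_exp.2 (mul_lt_mul_of_pos_left htt hc)) 1
  have h := curl_lundgren_le_of_circulation (γ := fun _ => c) (a := fun t => Real.exp (c * t / 2))
    (τ := fun t => (Real.exp (c * t) - 1) / c) (d := fun t => Real.exp (-(c * t))) hS' hν hv hω hBS hw
    hmaps ht₀ ht hτ (Real.exp_pos _).ne' hpos z₀ x
  refine ⟨h.1, h.2.trans (le_of_eq ?_)⟩
  dsimp only
  rw [exp_half_sq', ← exp_div_clock hc hν htt]
  ring

/-- **Signed cross-sections (v3): the swirl and the axial vorticity of Lundgren's stretched tube by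
the cross-section `L¹` norm `‖ω_z(t₀)‖_{L¹(section)}`, no co-sign assumed.** In the setting of
`norm_swirl_lundgren_le_of_circulation` WITHOUT `hpos`, with
`N = ∫ |ω_z(t₀, ιy + z₀e_z)| dy` (the planar `L¹` norm at Lundgren time `τ(t₀)`, Saffman (29)):
`‖a(t) ṽ(τ(t), a(t)y)‖ ≤ |a(t)| K N/(ν (τ(t) − τ(t₀)))^{1/2}` and
`|ω_z(t, x)| ≤ a(t)² · 8 C_GNS N/(ν (τ(t) − τ(t₀)))` (the `L¹` contraction replaces Kelvin).
[cite: Saffman1992, §13.3 eqs. (28)–(29)] [cite: GallayWayne2005, Thm. 1.1 eq. (1.2)] [cite: GallayWayne2002, Lemma 2.1 (b)] -/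
theorem norm_swirl_abs_curl_lundgren_le_of_crossSection (hS' : Convex ℝ S') (hν : 0 < ν)
    (hv : IsClassicalNSSolutionOn S' ν 0 v q)
    (hω : HasUniformRapidDecayOn S' (fun σ η => PlanarEigenmode.vorticity (v σ) η))
    (hBS : ∀ σ ∈ S', ∀ η, v σ η = biotSavart2D (PlanarEigenmode.vorticity (v σ)) η)
    (hw : IsSmoothSpaceTimeOn S' w) (hmaps : MapsTo τ S S') {t₀ t : ℝ} (ht₀ : t₀ ∈ S) (ht : t ∈ S)
    (hτ : τ t₀ < τ t) (ha₀ : a t₀ ≠ 0) (z₀ : ℝ) (y : EuclideanSpace ℝ (Fin 2))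
    (x : EuclideanSpace ℝ (Fin 3)) :
    ‖a t • v (τ t) (a t • y)‖ ≤
      |a t| * ((2 * Real.pi)⁻¹ * ((3 * Real.pi) ^ (3 / 4 : ℝ) *
        (128 / 3 * (lintegralPowLePowLIntegralFDerivConst
          (volume : Measure (EuclideanSpace ℝ (Fin 2))) 2 : ℝ) ^ 3) ^ (1 / 4 : ℝ) + 1) *
        (∫ y' : EuclideanSpace ℝ (Fin 2), |curl (velocity γ (fun t y => a t • v (τ t) (a t • y))
          (fun t y => d t • w (τ t) (a t • y)) t₀) (embedXY y' + z₀ • eZ) 2|) /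
        Real.sqrt (ν * (τ t - τ t₀))) ∧
    |curl (velocity γ (fun t y => a t • v (τ t) (a t • y)) (fun t y => d t • w (τ t) (a t • y)) t)
        x 2| ≤
      a t ^ 2 * (8 * (lintegralPowLePowLIntegralFDerivConst
        (volume : Measure (EuclideanSpace ℝ (Fin 2))) 2 : ℝ) *
        (∫ y' : EuclideanSpace ℝ (Fin 2), |curl (velocity γ (fun t y => a t • v (τ t) (a t • y))
          (fun t y => d t • w (τ t) (a t • y)) t₀) (embedXY y' + z₀ • eZ) 2|) /
        (ν * (τ t - τ t₀))) := by
  have hbdd : ∀ σ ∈ S', ∃ M : ℝ, ∀ η, ‖v σ η‖ ≤ M := fun σ hσ =>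
    exists_norm_le_of_hasUniformRapidDecayOn_of_eq_biotSavart2D hv.smooth_velocity hω hBS hσ
  have hcurl0 : ∀ σ ∈ S', ∀ η, PlanarEigenmode.vorticity
      ((0 : ℝ → EuclideanSpace ℝ (Fin 2) → EuclideanSpace ℝ (Fin 2)) σ) η = 0 :=
    fun σ _ η => planarVorticity_zero_force' σ η
  have hL1 := (moments_curl_lundgren_crossSection (γ := γ) (d := d) hv.smooth_velocity hw hmaps ht₀
    ha₀ z₀).1
  refine ⟨?_, ?_⟩
  · have hb := hv.norm_le_of_lt hS' hν hcurl0 hω hBS (hmaps ht₀) (hmaps ht) hτ (a t • y)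
    rw [← hL1] at hb
    rw [norm_smul, Real.norm_eq_abs]
    exact mul_le_mul_of_nonneg_left hb (abs_nonneg _)
  · have hb := hv.abs_planarVorticity_le hS' hν hcurl0 hω hbdd (hmaps ht₀) (hmaps ht) hτ
      (a t • projXY x)
    rw [← hL1] at hb
    rw [curl_lundgren_apply_two hv.smooth_velocity hw hmaps ht, abs_mul, abs_of_nonneg (sq_nonneg _)]
    exact mul_le_mul_of_nonneg_left hb (sq_nonneg _)

/-- **CONSTANT STRAIN, SIGNED CROSS-SECTIONS (v3)**: with `N = ∫|ω_z(t₀, ιy + z₀e_z)| dy`, for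
`t₀ < t` in `S` and all `y`, `x`:
`‖e^{ct/2} ṽ(τ(t), e^{ct/2}y)‖ ≤ K N (c/(ν (1 − e^{−c(t−t₀)})))^{1/2}` and
`|ω_z(t, x)| ≤ 8 C_GNS N c/(ν (1 − e^{−c(t−t₀)}))` — the Burgers scales, uniformly in time, for ANY
(signed) profile. [cite: Saffman1992, §13.3 eqs. (28)–(31)] [cite: GallayWayne2005, Thm. 1.1 eq. (1.2)] [cite: GallayWayne2002, Lemma 2.1 (b)] -/
theorem norm_swirl_abs_curl_lundgren_const_le_of_crossSection {c : ℝ} (hc : 0 < c)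
    (hS' : Convex ℝ S') (hν : 0 < ν) (hv : IsClassicalNSSolutionOn S' ν 0 v q)
    (hω : HasUniformRapidDecayOn S' (fun σ η => PlanarEigenmode.vorticity (v σ) η))
    (hBS : ∀ σ ∈ S', ∀ η, v σ η = biotSavart2D (PlanarEigenmode.vorticity (v σ)) η)
    (hw : IsSmoothSpaceTimeOn S' w) (hmaps : MapsTo (fun t => (Real.exp (c * t) - 1) / c) S S')
    {t₀ t : ℝ} (ht₀ : t₀ ∈ S) (ht : t ∈ S) (htt : t₀ < t) (z₀ : ℝ) (y : EuclideanSpace ℝ (Fin 2))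
    (x : EuclideanSpace ℝ (Fin 3)) :
    ‖Real.exp (c * t / 2) • v ((Real.exp (c * t) - 1) / c) (Real.exp (c * t / 2) • y)‖ ≤
      (2 * Real.pi)⁻¹ * ((3 * Real.pi) ^ (3 / 4 : ℝ) *
        (128 / 3 * (lintegralPowLePowLIntegralFDerivConst
          (volume : Measure (EuclideanSpace ℝ (Fin 2))) 2 : ℝ) ^ 3) ^ (1 / 4 : ℝ) + 1) *
        (∫ y' : EuclideanSpace ℝ (Fin 2), |curl (velocity (fun _ => c)
          (fun t y =>
            Real.exp (c * t / 2) • v ((Real.exp (c * t) - 1) / c) (Real.exp (c * t / 2) • y))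
          (fun t y =>
            Real.exp (-(c * t)) • w ((Real.exp (c * t) - 1) / c) (Real.exp (c * t / 2) • y)) t₀)
          (embedXY y' + z₀ • eZ) 2|) *
        Real.sqrt (c / (ν * (1 - Real.exp (-(c * (t - t₀)))))) ∧
    |curl (velocity (fun _ => c)
        (fun t y =>
          Real.exp (c * t / 2) • v ((Real.exp (c * t) - 1) / c) (Real.exp (c * t / 2) • y))
        (fun t y =>
          Real.exp (-(c * t)) • w ((Real.exp (c * t) - 1) / c) (Real.exp (c * t / 2) • y)) t)
        x 2| ≤
      8 * (lintegralPowLePowLIntegralFDerivConst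
        (volume : Measure (EuclideanSpace ℝ (Fin 2))) 2 : ℝ) *
        (∫ y' : EuclideanSpace ℝ (Fin 2), |curl (velocity (fun _ => c)
          (fun t y =>
            Real.exp (c * t / 2) • v ((Real.exp (c * t) - 1) / c) (Real.exp (c * t / 2) • y))
          (fun t y =>
            Real.exp (-(c * t)) • w ((Real.exp (c * t) - 1) / c) (Real.exp (c * t / 2) • y)) t₀)
          (embedXY y' + z₀ • eZ) 2|) *
        (c / (ν * (1 - Real.exp (-(c * (t - t₀)))))) := by
  have hτ : (Real.exp (c * t₀) - 1) / c < (Real.exp (c * t) - 1) / c := by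
    refine div_lt_div_of_pos_right ?_ hc
    exact sub_lt_sub_right (Real.exp_lt_exp.2 (mul_lt_mul_of_pos_left htt hc)) 1
  have h := norm_swirl_abs_curl_lundgren_le_of_crossSection (γ := fun _ => c)
    (a := fun t => Real.exp (c * t / 2)) (τ := fun t => (Real.exp (c * t) - 1) / c)
    (d := fun t => Real.exp (-(c * t))) hS' hν hv hω hBS hw hmaps ht₀ ht hτ (Real.exp_pos _).ne' z₀ y x
  refine ⟨h.1.trans (le_of_eq ?_), h.2.trans (le_of_eq ?_)⟩
  · rw [abs_of_pos (Real.exp_pos _), ← exp_half_div_sqrt_clock hc hν htt]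
    ring
  · dsimp only
    rw [exp_half_sq', ← exp_div_clock hc hν htt]
    ring

end SwirlCeiling

/-! ### §3 (v4, continued) Lundgren's stretched tube: the sharp-kernel / explicit-constant ceilings -/

section SwirlCeilingSharp

open MeasureTheory PlanarEigenmode InviscidShear

variable {S S' : Set ℝ} {ν : ℝ} {γ a τ d : ℝ → ℝ}
  {v : ℝ → EuclideanSpace ℝ (Fin 2) → EuclideanSpace ℝ (Fin 2)}
  {q : ℝ → EuclideanSpace ℝ (Fin 2) → ℝ} {w : ℝ → EuclideanSpace ℝ (Fin 2) → ℝ}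

/-- **The swirl speed of Lundgren's stretched tube, sharp-kernel form:** in the setting of
`norm_swirl_lundgren_le_of_circulation` (co-signed axial vorticity at `t₀`, cross-section circulation
`Γ`, `τ(t₀) < τ(t)`, `a(t₀) ≠ 0`), for every `y`:
`‖a(t) ṽ(τ(t), a(t) y)‖ ≤ |a(t)| · Γ / (4π ν (τ(t) − τ(t₀)))^{1/2}` — Saffman (29) composed with
`norm_le_div_sqrt_of_planarVorticity_nonneg_of_lt`. [cite: Saffman1992, §13.3 eqs. (28)–(29)] [cite: GallayWayne2005, Thm. 1.1 eq. (1.2) (p = ∞)] [cite: IftimieSiderisGamblin1999, Lemma 2.1] -/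
theorem norm_swirl_lundgren_le_of_circulation_sharp (hS' : Convex ℝ S') (hν : 0 < ν)
    (hv : IsClassicalNSSolutionOn S' ν 0 v q)
    (hω : HasUniformRapidDecayOn S' (fun σ η => PlanarEigenmode.vorticity (v σ) η))
    (hBS : ∀ σ ∈ S', ∀ η, v σ η = biotSavart2D (PlanarEigenmode.vorticity (v σ)) η)
    (hw : IsSmoothSpaceTimeOn S' w) (hmaps : MapsTo τ S S') {t₀ t : ℝ} (ht₀ : t₀ ∈ S) (ht : t ∈ S)
    (hτ : τ t₀ < τ t) (ha₀ : a t₀ ≠ 0)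
    (hpos : ∀ x : EuclideanSpace ℝ (Fin 3), 0 ≤ curl (velocity γ (fun t y => a t • v (τ t) (a t • y))
      (fun t y => d t • w (τ t) (a t • y)) t₀) x 2)
    (z₀ : ℝ) (y : EuclideanSpace ℝ (Fin 2)) :
    ‖a t • v (τ t) (a t • y)‖ ≤
      |a t| * ((∫ y' : EuclideanSpace ℝ (Fin 2), curl (velocity γ (fun t y => a t • v (τ t) (a t • y))
          (fun t y => d t • w (τ t) (a t • y)) t₀) (embedXY y' + z₀ • eZ) 2) /
        Real.sqrt (4 * Real.pi * ν * (τ t - τ t₀))) := by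
  have ha2 : 0 < a t₀ ^ 2 := by positivity
  have hplanar : ∀ η : EuclideanSpace ℝ (Fin 2),
      PlanarEigenmode.vorticity (v (τ t₀)) η =
        curl (velocity γ (fun t y => a t • v (τ t) (a t • y)) (fun t y => d t • w (τ t) (a t • y)) t₀)
          (embedXY ((a t₀)⁻¹ • η)) 2 / a t₀ ^ 2 := by
    intro η
    rw [curl_lundgren_apply_two hv.smooth_velocity hw hmaps ht₀, projXY_embedXY, smul_smul,
      mul_inv_cancel₀ ha₀, one_smul, mul_div_cancel_left₀ _ ha2.ne']
  have h0 : ∀ η, 0 ≤ PlanarEigenmode.vorticity (v (τ t₀)) η := fun η => by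
    rw [hplanar η]; exact div_nonneg (hpos _) ha2.le
  have hb := hv.norm_le_div_sqrt_of_planarVorticity_nonneg_of_lt hS' hν
    (fun σ _ η => planarVorticity_zero_force' σ η) hω hBS (hmaps ht₀) h0 (hmaps ht) hτ (a t • y)
  rw [← integral_curl_lundgren_crossSection hv.smooth_velocity hw hmaps ht₀ ha₀ z₀] at hb
  rw [norm_smul, Real.norm_eq_abs]
  exact mul_le_mul_of_nonneg_left hb (abs_nonneg _)

/-- The stretch factor against the Lundgren clock at constant strain, with a numerical prefactor
`κ > 0` under the root: `e^{ct/2} / (κ ν ((e^{ct}−1)/c − (e^{ct₀}−1)/c))^{1/2} =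
(c / (κ ν (1 − e^{−c(t−t₀)})))^{1/2}`. [folklore] -/
private theorem exp_half_div_sqrt_clock_mul {κ c ν t₀ t : ℝ} (hκ : 0 < κ) (hc : 0 < c) (hν : 0 < ν)
    (htt : t₀ < t) :
    Real.exp (c * t / 2) /
        Real.sqrt (κ * ν * ((Real.exp (c * t) - 1) / c - (Real.exp (c * t₀) - 1) / c)) =
      Real.sqrt (c / (κ * ν * (1 - Real.exp (-(c * (t - t₀)))))) := by
  have h := exp_half_div_sqrt_clock (ν := κ * ν) hc (mul_pos hκ hν) htt
  exact h

/-- **CONSTANT STRAIN, SHARP-KERNEL FORM: `‖swirl(t)‖_∞ ≤ Γ (c / (4πν(1 − e^{−c(t−t₀)})))^{1/2}`.**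
For Lundgren's stretched tube with clocks `a = e^{ct/2}`, `τ = (e^{ct} − 1)/c`, `d = e^{−ct}`
carrying ANY co-signed planar cross-section (classical, unforced, `ν > 0`, uniformly rapidly decaying
vorticity, `ṽ = K₂ ∗ ω̃`) and `t₀ < t` in `S`, for every `y`:
`‖e^{ct/2} ṽ(τ(t), e^{ct/2} y)‖ ≤ Γ · (c / (4π ν (1 − e^{−c(t − t₀)})))^{1/2}` — a NUMERIC ceiling at
the Burgers scale `Γ(c/ν)^{1/2}`: prefactor `(4π)^{-1/2} ≈ 0.2821` (after one strain time `× 1.26`),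
against the tree's floor `(8π)⁻¹ρ^{-1/2} ≈ 0.0398ρ^{-1/2}` after the compaction budget
(`integral_curl_lundgren_const_swirl_floor_of_budget`) and the Burgers vortex' own maximal swirl
`≈ 0.0508·Γ(c/ν)^{1/2}`. Supersedes numerically `norm_swirl_lundgren_const_le_of_circulation`
(`K(C_GNS)`, not evaluated). [cite: Saffman1992, §13.3 eqs. (28)–(31)] [cite: GallayWayne2005, Thm. 1.1 eq. (1.2) (p = ∞)] [cite: IftimieSiderisGamblin1999, Lemma 2.1] -/
theorem norm_swirl_lundgren_const_le_of_circulation_sharp {c : ℝ} (hc : 0 < c) (hS' : Convex ℝ S')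
    (hν : 0 < ν) (hv : IsClassicalNSSolutionOn S' ν 0 v q)
    (hω : HasUniformRapidDecayOn S' (fun σ η => PlanarEigenmode.vorticity (v σ) η))
    (hBS : ∀ σ ∈ S', ∀ η, v σ η = biotSavart2D (PlanarEigenmode.vorticity (v σ)) η)
    (hw : IsSmoothSpaceTimeOn S' w) (hmaps : MapsTo (fun t => (Real.exp (c * t) - 1) / c) S S')
    {t₀ t : ℝ} (ht₀ : t₀ ∈ S) (ht : t ∈ S) (htt : t₀ < t)
    (hpos : ∀ x : EuclideanSpace ℝ (Fin 3),
      0 ≤ curl (velocity (fun _ => c)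
          (fun t y =>
            Real.exp (c * t / 2) • v ((Real.exp (c * t) - 1) / c) (Real.exp (c * t / 2) • y))
          (fun t y =>
            Real.exp (-(c * t)) • w ((Real.exp (c * t) - 1) / c) (Real.exp (c * t / 2) • y)) t₀)
          x 2)
    (z₀ : ℝ) (y : EuclideanSpace ℝ (Fin 2)) :
    ‖Real.exp (c * t / 2) • v ((Real.exp (c * t) - 1) / c) (Real.exp (c * t / 2) • y)‖ ≤
      (∫ y' : EuclideanSpace ℝ (Fin 2), curl (velocity (fun _ => c)
          (fun t y =>
            Real.exp (c * t / 2) • v ((Real.exp (c * t) - 1) / c) (Real.exp (c * t / 2) • y))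
          (fun t y =>
            Real.exp (-(c * t)) • w ((Real.exp (c * t) - 1) / c) (Real.exp (c * t / 2) • y)) t₀)
          (embedXY y' + z₀ • eZ) 2) *
        Real.sqrt (c / (4 * Real.pi * ν * (1 - Real.exp (-(c * (t - t₀)))))) := by
  have hτ : (Real.exp (c * t₀) - 1) / c < (Real.exp (c * t) - 1) / c := by
    refine div_lt_div_of_pos_right ?_ hc
    exact sub_lt_sub_right (Real.exp_lt_exp.2 (mul_lt_mul_of_pos_left htt hc)) 1
  have h := norm_swirl_lundgren_le_of_circulation_sharp (γ := fun _ => c)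
    (a := fun t => Real.exp (c * t / 2)) (τ := fun t => (Real.exp (c * t) - 1) / c)
    (d := fun t => Real.exp (-(c * t))) hS' hν hv hω hBS hw hmaps ht₀ ht hτ (Real.exp_pos _).ne' hpos z₀ y
  rw [abs_of_pos (Real.exp_pos _)] at h
  refine h.trans (le_of_eq ?_)
  rw [← exp_half_div_sqrt_clock_mul (by positivity : (0 : ℝ) < 4 * Real.pi) hc hν htt,
    show 4 * Real.pi * ν * ((Real.exp (c * t) - 1) / c - (Real.exp (c * t₀) - 1) / c) =
      4 * Real.pi * ν * (((Real.exp (c * t) - 1) / c) - ((Real.exp (c * t₀) - 1) / c)) from rfl]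
  ring

/-- **The axial vorticity of Lundgren's stretched tube, explicit constant:** in the setting of
`curl_lundgren_le_of_circulation`, `0 ≤ ω_z(t, x) ≤ a(t)² · Γ / (ν (τ(t) − τ(t₀)))` for every `x ∈ ℝ³`
— Saffman (29) with the explicit planar peak bound `0 ≤ ω̃(τ) ≤ Γ/(ν(τ − τ₀))`
(`planarVorticity_le_of_nonneg_explicit`, Nash constant `1/8`).
[cite: Saffman1992, §13.3 eqs. (28)–(29)] [cite: GallayWayne2005, Thm. 1.1 eq. (1.2) (p = ∞)] [cite: CarlenLoss1995, Thm. 1] -/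
theorem curl_lundgren_le_of_circulation_explicit (hS' : Convex ℝ S') (hν : 0 < ν)
    (hv : IsClassicalNSSolutionOn S' ν 0 v q)
    (hω : HasUniformRapidDecayOn S' (fun σ η => PlanarEigenmode.vorticity (v σ) η))
    (hBS : ∀ σ ∈ S', ∀ η, v σ η = biotSavart2D (PlanarEigenmode.vorticity (v σ)) η)
    (hw : IsSmoothSpaceTimeOn S' w) (hmaps : MapsTo τ S S') {t₀ t : ℝ} (ht₀ : t₀ ∈ S) (ht : t ∈ S)
    (hτ : τ t₀ < τ t) (ha₀ : a t₀ ≠ 0)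
    (hpos : ∀ x : EuclideanSpace ℝ (Fin 3), 0 ≤ curl (velocity γ (fun t y => a t • v (τ t) (a t • y))
      (fun t y => d t • w (τ t) (a t • y)) t₀) x 2)
    (z₀ : ℝ) (x : EuclideanSpace ℝ (Fin 3)) :
    0 ≤ curl (velocity γ (fun t y => a t • v (τ t) (a t • y)) (fun t y => d t • w (τ t) (a t • y)) t)
        x 2 ∧
      curl (velocity γ (fun t y => a t • v (τ t) (a t • y)) (fun t y => d t • w (τ t) (a t • y)) t)
          x 2 ≤
        a t ^ 2 * ((∫ y' : EuclideanSpace ℝ (Fin 2), curl (velocity γ (fun t y => a t • v (τ t) (a t • y))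
            (fun t y => d t • w (τ t) (a t • y)) t₀) (embedXY y' + z₀ • eZ) 2) /
          (ν * (τ t - τ t₀))) := by
  have ha2 : 0 < a t₀ ^ 2 := by positivity
  have hplanar : ∀ η : EuclideanSpace ℝ (Fin 2),
      PlanarEigenmode.vorticity (v (τ t₀)) η =
        curl (velocity γ (fun t y => a t • v (τ t) (a t • y)) (fun t y => d t • w (τ t) (a t • y)) t₀)
          (embedXY ((a t₀)⁻¹ • η)) 2 / a t₀ ^ 2 := by
    intro η
    rw [curl_lundgren_apply_two hv.smooth_velocity hw hmaps ht₀, projXY_embedXY, smul_smul,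
      mul_inv_cancel₀ ha₀, one_smul, mul_div_cancel_left₀ _ ha2.ne']
  have h0 : ∀ η, 0 ≤ PlanarEigenmode.vorticity (v (τ t₀)) η := fun η => by
    rw [hplanar η]; exact div_nonneg (hpos _) ha2.le
  have hbdd : ∀ σ ∈ S', ∃ M : ℝ, ∀ η, ‖v σ η‖ ≤ M := fun σ hσ =>
    exists_norm_le_of_hasUniformRapidDecayOn_of_eq_biotSavart2D hv.smooth_velocity hω hBS hσ
  have hcurl0 : ∀ σ ∈ S', ∀ η, PlanarEigenmode.vorticity
      ((0 : ℝ → EuclideanSpace ℝ (Fin 2) → EuclideanSpace ℝ (Fin 2)) σ) η = 0 :=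
    fun σ _ η => planarVorticity_zero_force' σ η
  have hboth := fun η => hv.planarVorticity_le_of_nonneg_explicit hS' hν hcurl0 hω hbdd (hmaps ht₀) h0
    (hmaps ht) hτ η
  rw [curl_lundgren_apply_two hv.smooth_velocity hw hmaps ht]
  have hup := (hboth (a t • projXY x)).2
  rw [← integral_curl_lundgren_crossSection hv.smooth_velocity hw hmaps ht₀ ha₀ z₀] at hup
  exact ⟨mul_nonneg (sq_nonneg _) (hboth _).1, mul_le_mul_of_nonneg_left hup (sq_nonneg _)⟩

/-- **CONSTANT STRAIN, EXPLICIT CONSTANT: `0 ≤ ω_z(t, x) ≤ Γ c / (ν (1 − e^{−c(t − t₀)}))`** for every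
`x ∈ ℝ³` and `t₀ < t` in `S` (Lundgren's tube with `a = e^{ct/2}`, `τ = (e^{ct} − 1)/c`, `d = e^{−ct}`,
ANY co-signed cross-section): the peak axial vorticity saturates at the Burgers scale `Γc/ν` with
prefactor `1` (after one strain time `× (63/50)²`; Burgers' own peak `Γc/(4πν)`, the tree's floor after
the compaction budget `Γc/(8πνρ)`). Supersedes numerically `curl_lundgren_const_le_of_circulation`
(`8 C_GNS`). [cite: Saffman1992, §13.3 eqs. (28)–(31)] [cite: GallayWayne2005, Thm. 1.1 eq. (1.2) (p = ∞)] [cite: CarlenLoss1995, Thm. 1] -/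
theorem curl_lundgren_const_le_of_circulation_explicit {c : ℝ} (hc : 0 < c) (hS' : Convex ℝ S')
    (hν : 0 < ν) (hv : IsClassicalNSSolutionOn S' ν 0 v q)
    (hω : HasUniformRapidDecayOn S' (fun σ η => PlanarEigenmode.vorticity (v σ) η))
    (hBS : ∀ σ ∈ S', ∀ η, v σ η = biotSavart2D (PlanarEigenmode.vorticity (v σ)) η)
    (hw : IsSmoothSpaceTimeOn S' w) (hmaps : MapsTo (fun t => (Real.exp (c * t) - 1) / c) S S')
    {t₀ t : ℝ} (ht₀ : t₀ ∈ S) (ht : t ∈ S) (htt : t₀ < t)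
    (hpos : ∀ x : EuclideanSpace ℝ (Fin 3),
      0 ≤ curl (velocity (fun _ => c)
          (fun t y =>
            Real.exp (c * t / 2) • v ((Real.exp (c * t) - 1) / c) (Real.exp (c * t / 2) • y))
          (fun t y =>
            Real.exp (-(c * t)) • w ((Real.exp (c * t) - 1) / c) (Real.exp (c * t / 2) • y)) t₀)
          x 2)
    (z₀ : ℝ) (x : EuclideanSpace ℝ (Fin 3)) :
    0 ≤ curl (velocity (fun _ => c)
          (fun t y =>
            Real.exp (c * t / 2) • v ((Real.exp (c * t) - 1) / c) (Real.exp (c * t / 2) • y))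
          (fun t y =>
            Real.exp (-(c * t)) • w ((Real.exp (c * t) - 1) / c) (Real.exp (c * t / 2) • y)) t)
          x 2 ∧
      curl (velocity (fun _ => c)
          (fun t y =>
            Real.exp (c * t / 2) • v ((Real.exp (c * t) - 1) / c) (Real.exp (c * t / 2) • y))
          (fun t y =>
            Real.exp (-(c * t)) • w ((Real.exp (c * t) - 1) / c) (Real.exp (c * t / 2) • y)) t)
          x 2 ≤
        (∫ y' : EuclideanSpace ℝ (Fin 2), curl (velocity (fun _ => c)
            (fun t y =>
              Real.exp (c * t / 2) • v ((Real.exp (c * t) - 1) / c) (Real.exp (c * t / 2) • y))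
            (fun t y =>
              Real.exp (-(c * t)) • w ((Real.exp (c * t) - 1) / c) (Real.exp (c * t / 2) • y)) t₀)
            (embedXY y' + z₀ • eZ) 2) *
          (c / (ν * (1 - Real.exp (-(c * (t - t₀)))))) := by
  have hτ : (Real.exp (c * t₀) - 1) / c < (Real.exp (c * t) - 1) / c := by
    refine div_lt_div_of_pos_right ?_ hc
    exact sub_lt_sub_right (Real.exp_lt_exp.2 (mul_lt_mul_of_pos_left htt hc)) 1
  have h := curl_lundgren_le_of_circulation_explicit (γ := fun _ => c)
    (a := fun t => Real.exp (c * t / 2)) (τ := fun t => (Real.exp (c * t) - 1) / c)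
    (d := fun t => Real.exp (-(c * t))) hS' hν hv hω hBS hw hmaps ht₀ ht hτ (Real.exp_pos _).ne' hpos z₀ x
  refine ⟨h.1, h.2.trans (le_of_eq ?_)⟩
  dsimp only
  rw [exp_half_sq', ← exp_div_clock hc hν htt]
  ring

/-- **Signed cross-sections, explicit constants:** in the setting of
`norm_swirl_abs_curl_lundgren_le_of_crossSection` (no co-sign; `N = ∫|ω_z(t₀, ιy + z₀e_z)| dy`):
`‖a(t) ṽ(τ(t), a(t)y)‖ ≤ |a(t)| N/(2πν(τ(t) − τ(t₀)))^{1/2}` and `|ω_z(t, x)| ≤ a(t)² N/(ν(τ(t) − τ(t₀)))`.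
[cite: Saffman1992, §13.3 eqs. (28)–(29)] [cite: GallayWayne2005, Thm. 1.1 eq. (1.2)] [cite: IftimieSiderisGamblin1999, Lemma 2.1] -/
theorem norm_swirl_abs_curl_lundgren_le_of_crossSection_explicit (hS' : Convex ℝ S') (hν : 0 < ν)
    (hv : IsClassicalNSSolutionOn S' ν 0 v q)
    (hω : HasUniformRapidDecayOn S' (fun σ η => PlanarEigenmode.vorticity (v σ) η))
    (hBS : ∀ σ ∈ S', ∀ η, v σ η = biotSavart2D (PlanarEigenmode.vorticity (v σ)) η)
    (hw : IsSmoothSpaceTimeOn S' w) (hmaps : MapsTo τ S S') {t₀ t : ℝ} (ht₀ : t₀ ∈ S) (ht : t ∈ S)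
    (hτ : τ t₀ < τ t) (ha₀ : a t₀ ≠ 0) (z₀ : ℝ) (y : EuclideanSpace ℝ (Fin 2))
    (x : EuclideanSpace ℝ (Fin 3)) :
    ‖a t • v (τ t) (a t • y)‖ ≤
      |a t| * ((∫ y' : EuclideanSpace ℝ (Fin 2), |curl (velocity γ (fun t y => a t • v (τ t) (a t • y))
          (fun t y => d t • w (τ t) (a t • y)) t₀) (embedXY y' + z₀ • eZ) 2|) /
        Real.sqrt (2 * Real.pi * ν * (τ t - τ t₀))) ∧
    |curl (velocity γ (fun t y => a t • v (τ t) (a t • y)) (fun t y => d t • w (τ t) (a t • y)) t)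
        x 2| ≤
      a t ^ 2 * ((∫ y' : EuclideanSpace ℝ (Fin 2), |curl (velocity γ (fun t y => a t • v (τ t) (a t • y))
          (fun t y => d t • w (τ t) (a t • y)) t₀) (embedXY y' + z₀ • eZ) 2|) /
        (ν * (τ t - τ t₀))) := by
  have hbdd : ∀ σ ∈ S', ∃ M : ℝ, ∀ η, ‖v σ η‖ ≤ M := fun σ hσ =>
    exists_norm_le_of_hasUniformRapidDecayOn_of_eq_biotSavart2D hv.smooth_velocity hω hBS hσ
  have hcurl0 : ∀ σ ∈ S', ∀ η, PlanarEigenmode.vorticity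
      ((0 : ℝ → EuclideanSpace ℝ (Fin 2) → EuclideanSpace ℝ (Fin 2)) σ) η = 0 :=
    fun σ _ η => planarVorticity_zero_force' σ η
  have hL1 := (moments_curl_lundgren_crossSection (γ := γ) (d := d) hv.smooth_velocity hw hmaps ht₀
    ha₀ z₀).1
  refine ⟨?_, ?_⟩
  · have hb := hv.norm_le_div_sqrt_of_lt hS' hν hcurl0 hω hBS (hmaps ht₀) (hmaps ht) hτ (a t • y)
    rw [← hL1] at hb
    rw [norm_smul, Real.norm_eq_abs]
    exact mul_le_mul_of_nonneg_left hb (abs_nonneg _)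
  · have hb := hv.abs_planarVorticity_le_explicit hS' hν hcurl0 hω hbdd (hmaps ht₀) (hmaps ht) hτ
      (a t • projXY x)
    rw [← hL1] at hb
    rw [curl_lundgren_apply_two hv.smooth_velocity hw hmaps ht, abs_mul, abs_of_nonneg (sq_nonneg _)]
    exact mul_le_mul_of_nonneg_left hb (sq_nonneg _)

/-- **CONSTANT STRAIN, SIGNED CROSS-SECTIONS, explicit constants:** with `N = ∫|ω_z(t₀, ιy + z₀e_z)| dy`,
for `t₀ < t` in `S` and all `y`, `x`:
`‖e^{ct/2} ṽ(τ(t), e^{ct/2}y)‖ ≤ N (c/(2πν(1 − e^{−c(t−t₀)})))^{1/2}` and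
`|ω_z(t, x)| ≤ N c/(ν (1 − e^{−c(t−t₀)}))`. [cite: Saffman1992, §13.3 eqs. (28)–(31)] [cite: GallayWayne2005, Thm. 1.1 eq. (1.2)] [cite: IftimieSiderisGamblin1999, Lemma 2.1] -/
theorem norm_swirl_abs_curl_lundgren_const_le_of_crossSection_explicit {c : ℝ} (hc : 0 < c)
    (hS' : Convex ℝ S') (hν : 0 < ν) (hv : IsClassicalNSSolutionOn S' ν 0 v q)
    (hω : HasUniformRapidDecayOn S' (fun σ η => PlanarEigenmode.vorticity (v σ) η))
    (hBS : ∀ σ ∈ S', ∀ η, v σ η = biotSavart2D (PlanarEigenmode.vorticity (v σ)) η)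
    (hw : IsSmoothSpaceTimeOn S' w) (hmaps : MapsTo (fun t => (Real.exp (c * t) - 1) / c) S S')
    {t₀ t : ℝ} (ht₀ : t₀ ∈ S) (ht : t ∈ S) (htt : t₀ < t) (z₀ : ℝ) (y : EuclideanSpace ℝ (Fin 2))
    (x : EuclideanSpace ℝ (Fin 3)) :
    ‖Real.exp (c * t / 2) • v ((Real.exp (c * t) - 1) / c) (Real.exp (c * t / 2) • y)‖ ≤
      (∫ y' : EuclideanSpace ℝ (Fin 2), |curl (velocity (fun _ => c)
          (fun t y =>
            Real.exp (c * t / 2) • v ((Real.exp (c * t) - 1) / c) (Real.exp (c * t / 2) • y))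
          (fun t y =>
            Real.exp (-(c * t)) • w ((Real.exp (c * t) - 1) / c) (Real.exp (c * t / 2) • y)) t₀)
          (embedXY y' + z₀ • eZ) 2|) *
        Real.sqrt (c / (2 * Real.pi * ν * (1 - Real.exp (-(c * (t - t₀)))))) ∧
    |curl (velocity (fun _ => c)
        (fun t y =>
          Real.exp (c * t / 2) • v ((Real.exp (c * t) - 1) / c) (Real.exp (c * t / 2) • y))
        (fun t y =>
          Real.exp (-(c * t)) • w ((Real.exp (c * t) - 1) / c) (Real.exp (c * t / 2) • y)) t)
        x 2| ≤
      (∫ y' : EuclideanSpace ℝ (Fin 2), |curl (velocity (fun _ => c)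
          (fun t y =>
            Real.exp (c * t / 2) • v ((Real.exp (c * t) - 1) / c) (Real.exp (c * t / 2) • y))
          (fun t y =>
            Real.exp (-(c * t)) • w ((Real.exp (c * t) - 1) / c) (Real.exp (c * t / 2) • y)) t₀)
          (embedXY y' + z₀ • eZ) 2|) *
        (c / (ν * (1 - Real.exp (-(c * (t - t₀)))))) := by
  have hτ : (Real.exp (c * t₀) - 1) / c < (Real.exp (c * t) - 1) / c := by
    refine div_lt_div_of_pos_right ?_ hc
    exact sub_lt_sub_right (Real.exp_lt_exp.2 (mul_lt_mul_of_pos_left htt hc)) 1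
  have h := norm_swirl_abs_curl_lundgren_le_of_crossSection_explicit (γ := fun _ => c)
    (a := fun t => Real.exp (c * t / 2)) (τ := fun t => (Real.exp (c * t) - 1) / c)
    (d := fun t => Real.exp (-(c * t))) hS' hν hv hω hBS hw hmaps ht₀ ht hτ (Real.exp_pos _).ne' z₀ y x
  refine ⟨h.1.trans (le_of_eq ?_), h.2.trans (le_of_eq ?_)⟩
  · rw [abs_of_pos (Real.exp_pos _),
      ← exp_half_div_sqrt_clock_mul (by positivity : (0 : ℝ) < 2 * Real.pi) hc hν htt,
      show 2 * Real.pi * ν * ((Real.exp (c * t) - 1) / c - (Real.exp (c * t₀) - 1) / c) =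
        2 * Real.pi * ν * (((Real.exp (c * t) - 1) / c) - ((Real.exp (c * t₀) - 1) / c)) from rfl]
    ring
  · dsimp only
    rw [exp_half_sq', ← exp_div_clock hc hν htt]
    ring

/-- **Early window, sharp kinematic constant (v5): the swirl grows at most like `S^{1/2}` times
`(BΓ/4π)^{1/2}`.** In the setting of `LundgrenCrossSectionMoments.norm_swirl_lundgren_le_sqrt`
(co-signed axial vorticity `0 ≤ ω_z(t₀, ·) ≤ B`, cross-section circulation `Γ`, `τ(t₀) ≤ τ(t)`,
`a(t₀) ≠ 0`, `ν ≥ 0`): `‖a(t) ṽ(τ(t), a(t) y)‖ ≤ |a(t)| (B a(t₀)⁻² Γ/4π)^{1/2}` — Saffman (29) with the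
time-uniform SHARP bound `IsClassicalNSSolutionOn.norm_le_sqrt_of_planarVorticity_nonneg`
(`(AΩ₂/4π)^{1/2}`, Rankine-optimal) in place of MB (8.27)'s `2(AΩ₂/2π)^{1/2}`: the tree's bound ÷ 2√2.
This is the early-window companion of the late-window ceiling `norm_swirl_lundgren_const_le_of_circulation_sharp`.
[cite: Saffman1992, §13.3 eqs. (28)–(29)] [cite: MajdaBertozziCUP2002, §3.3; §1.7 Prop. 1.14 (i)] [cite: IftimieSiderisGamblin1999, Lemma 2.1] -/
theorem norm_swirl_lundgren_le_sqrt_sharp (hS' : Convex ℝ S') (hν : 0 ≤ ν)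
    (hv : IsClassicalNSSolutionOn S' ν 0 v q)
    (hω : HasUniformRapidDecayOn S' (fun σ η => PlanarEigenmode.vorticity (v σ) η))
    (hBS : ∀ σ ∈ S', ∀ η, v σ η = biotSavart2D (PlanarEigenmode.vorticity (v σ)) η)
    (hw : IsSmoothSpaceTimeOn S' w) (hmaps : MapsTo τ S S') {t₀ t : ℝ} (ht₀ : t₀ ∈ S) (ht : t ∈ S)
    (hτ : τ t₀ ≤ τ t) (ha₀ : a t₀ ≠ 0)
    (hpos : ∀ x : EuclideanSpace ℝ (Fin 3), 0 ≤ curl (velocity γ (fun t y => a t • v (τ t) (a t • y))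
      (fun t y => d t • w (τ t) (a t • y)) t₀) x 2)
    {B : ℝ} (hB : ∀ x : EuclideanSpace ℝ (Fin 3), curl (velocity γ (fun t y => a t • v (τ t) (a t • y))
      (fun t y => d t • w (τ t) (a t • y)) t₀) x 2 ≤ B)
    (z₀ : ℝ) (y : EuclideanSpace ℝ (Fin 2)) :
    ‖a t • v (τ t) (a t • y)‖ ≤
      |a t| * Real.sqrt (B / a t₀ ^ 2 *
        (∫ y' : EuclideanSpace ℝ (Fin 2), curl (velocity γ (fun t y => a t • v (τ t) (a t • y))
          (fun t y => d t • w (τ t) (a t • y)) t₀) (embedXY y' + z₀ • eZ) 2) / (4 * Real.pi)) := by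
  have ha2 : 0 < a t₀ ^ 2 := by positivity
  have hplanar : ∀ η : EuclideanSpace ℝ (Fin 2),
      PlanarEigenmode.vorticity (v (τ t₀)) η =
        curl (velocity γ (fun t y => a t • v (τ t) (a t • y)) (fun t y => d t • w (τ t) (a t • y)) t₀)
          (embedXY ((a t₀)⁻¹ • η)) 2 / a t₀ ^ 2 := by
    intro η
    rw [curl_lundgren_apply_two hv.smooth_velocity hw hmaps ht₀, projXY_embedXY, smul_smul,
      mul_inv_cancel₀ ha₀, one_smul, mul_div_cancel_left₀ _ ha2.ne']
  have h0 : ∀ η, 0 ≤ PlanarEigenmode.vorticity (v (τ t₀)) η := fun η => by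
    rw [hplanar η]; exact div_nonneg (hpos _) ha2.le
  have hA : ∀ η, PlanarEigenmode.vorticity (v (τ t₀)) η ≤ B / a t₀ ^ 2 := fun η => by
    rw [hplanar η]; exact div_le_div_of_nonneg_right (hB _) ha2.le
  have hb := hv.norm_le_sqrt_of_planarVorticity_nonneg hS' hν
    (fun σ _ η => planarVorticity_zero_force' σ η) hω hBS (hmaps ht₀) h0 hA (hmaps ht) hτ (a t • y)
  rw [← integral_curl_lundgren_crossSection hv.smooth_velocity hw hmaps ht₀ ha₀ z₀] at hb
  rw [norm_smul, Real.norm_eq_abs]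
  exact mul_le_mul_of_nonneg_left hb (abs_nonneg _)

end SwirlCeilingSharp

end Lundgren


end Literature.Analysis.FluidPDE
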